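import Mathlib.Analysis.Real.Pi.Bounds
import Literature.NumberTheory.LFunctions.AlternativeHypothesis
import Literature.NumberTheory.LFunctions.AlternativeHypothesisESHProofs
import Literature.NumberTheory.LFunctions.RudnickSarnakPairSmoothed
import Literature.NumberTheory.LFunctions.SimpleZeros
import Literature.NumberTheory.LFunctions.ZeroCountingLevinsonProofs
import HarnessLib

/-!
# Consequences of the Alternative Hypothesis: Goldston–Lee–Schettler–Suriajaya 2026, Aryan 2019

LABEL (cell `rh-crit`, corpus C5 `ah`): **NOT RH-BEARING.** Corpus theorems are RH-FREE literature;
every conditional below is typed with its hypotheses EXPLICIT (`RiemannHypothesis → …`, an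
Alternative-Hypothesis PREDICATE `→ …`); the Alternative Hypothesis and its variants are plain
PREDICATES consumed as hypotheses, never asserted and never Literature facts; unproved printed
theorems are NAMED FACTS (`def … : Prop`, D-0014), elementary deductions are PROVED. bears_on:
LADDER-RH §4 HELD «conditional bridges: exceptional zero ⇒ …». WHAT THIS IS NOT: a claim about RH,
about the truth of AH, or about the existence of Landau–Siegel zeros; nothing here bears on the
truth of RH.

Topic `Literature/NumberTheory/LFunctions` (namespace `Literature.NumberTheory.LFunctions`; the
paper-internal objects live in the sub-namespaces `GLSS2026` and `Aryan2019`).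

## Sources (held texts, locators opened 2026-08-26)

* [GoldstonLeeSchettlerSuriajaya2026] D. A. Goldston, J. Lee, J. Schettler, A. I. Suriajaya, *Pair
  correlation conjecture for the zeros of the Riemann zeta-function II: The Alternative
  Hypothesis*, J. Number Theory (2026), doi:10.1016/j.jnt.2026.05.010, arXiv:2507.06823 (held
  `paper:arxiv-2507.06823`), §1 pp. 1–4 (chunks p0003–p0005), §2 (p0006), §4 (p0008). "Throughout
  this paper we do not assume RH."
* [Aryan2019] F. Aryan, *A new approach to gaps between zeta zeros*, arXiv:1910.02408 (2019,
  PREPRINT), §1 p. 2 (chunk p0003: AH in the Farmer–Gonek–Lee form, Theorem 1.1), §3 (chunk p0006: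
  proof of Theorem 1.1). UNREFEREED: `[claim: Aryan2019, status: under-review]`.
* Baluyot, J. Number Theory 169 (2016) 183–226 [Baluyot2016AH]: the held text
  (`paper:doi-10-1016-j-jnt-2016-05-007`, s2orc) drops every displayed formula; its Theorems
  1.3/1.5, Corollary 1.4, Proposition 5.3 WAIT for the publisher PDF (cell want acq-11180) and are
  NOT typed here. Its formulation of AH is the one restated by Baluyot–Goldston–Suriajaya–
  Turnage-Butterbaugh 2025 and typed in `AlternativeHypothesis.lean` (corpus file of seat t5).

## Part A — GLSS 2026 vocabulary that is the paper's own (§1, pp. 1–3)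

With `N(T)` the number of zeros `ρ = β + iγ`, `0 < γ ≤ T`, counted with multiplicity
(`zetaZeroCount`; pairs "`ρ, ρ'` with `0 < γ, γ' ≤ T`" counted with multiplicity are pairs of
indices in `zeroIndexSet T`, `ZeroStatistics.lean`) and `L := (1/2π) log T`:
* (N(T,U)) `N(T, λ) := #{(ρ, ρ') : 0 < γ, γ' ≤ T, 0 < (γ − γ')L ≤ λ}` — `GLSS2026.pairCount`;
* (N*) `N*(T) := Σ_{ρ, 0<γ≤T} m_ρ = Σ_{ρ distinct} m_ρ²` — written, as in the tree's
  `SimpleZeros.lean`, `∑ᶠ ρ ∈ zetaZeroBox 0 T, riemannZetaZeroOrder ρ ^ 2`;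
* `N⊛(T) := #{(ρ, ρ') : 0 < γ, γ' ≤ T, γ = γ'}` — `GLSS2026.coincidentPairCount`, equal to the
  tree's `pairCorrelationCount 0 0 T` (`coincidentPairCount_eq_pairCorrelationCount`, proved);
* **ESH** in the precise form of [GLSS1]/this paper: (ES1) `N⊛(T) = TL + o(TL)` and (ES2)
  `N(T, λ₀) = o(TL)` if `λ₀ → 0` as `T → ∞` — `GLSS2026.ES1`, `GLSS2026.ES2`, `GLSS2026.ESH`.
  Typed as printed by GLSS, SEPARATELY from the tree's `EssentialSimplicityHypothesis` (the
  Mueller 1983 / Ivić 2002 pair-count form chosen by seat t5 for the informal ESH sentence of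
  Baluyot–Goldston–Suriajaya–Turnage-Butterbaugh 2025, p. 3); the two typings are then PROVED
  EQUIVALENT (Part D, `GLSS2026.esh_iff_essentialSimplicityHypothesis`; referee test T-4).
* `N_0(T) := Σ_{ρ, 0<γ≤T, β=1/2} 1` = tree `criticalZeroCount T` (with multiplicity);
  `N_s(T) := Σ_{ρ simple, 0<γ≤T} 1` = tree `simpleZeroCount T` (`SimpleZeros.lean`).

## Part B — GLSS 2026, Theorems 1–4, Corollaries 1–2, the model (AH1)/(AH2) (§1 pp. 2–4)

GLSS 2026 COPY the pair vocabulary of Baluyot–Goldston–Suriajaya–Turnage-Butterbaugh 2025 ("Our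
starting point is the following formulation of AH from [BGST-AH]"): `𝒫(T, M)` = `AH.pairs T M`,
(AH0) = BGSTB (AH2k) = `AHPairsAt M` / `AHPairs`, `B_{k/2}(T)` = `AH.bin k T M δ` with the FIXED
half-width `δ = 1/2` (window `k/2 ∓ 1/4`, GLSS (1.10)), `P_{k/2}(T) = (TL)⁻¹|B_{k/2}(T)|` =
`AH.binDensity k T M (1/2)` (same normalisation `TL = (T/2π) log T`), "`p_{k/2} := lim P_{k/2}(T)`
exists" = `AH.HasLimitingDensity k (1/2) p` — all CITED from `AlternativeHypothesis.lean` (seat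
t5), nothing re-minted. GLSS-specific: the unbundled AH-Pairs data `(R, C)` at level `M`
(`GLSS2026.IsAHPairsWitness`, with `AHPairsAt M ↔ ∃ R C, …` PROVED), the `M`-free density
`GLSS2026.dens k T` (the value of `P_{k/2}(T)` at any level `M ≥ (|k| + ½)/2`, by t5's
`AH.binDensity_eq_binDensity_of_le`), and the MODEL (AH1)/(AH2) = "AH-Weak Density"
(`GLSS2026.AH1`, `GLSS2026.AH2`, `GLSS2026.AHWeakDensity`) — hypotheses the paper formulates
("The simplest assumption is …"), typed as PREDICATES.
* **Theorem 1** (p. 3): "Assuming AH-Pairs, we have that `p_0 = 1` is equivalent to ESH." —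
  `glss2026_theorem1` (named fact; refereed).
* **Corollary 1**: "Assuming AH-Pairs, if `p_0 = 1`, then asymptotically 100% of the zeros of
  `ζ(s)` are simple and on the critical line." — `glss2026_corollary1`; DISCHARGED
  (`glss2026_corollary1_holds`, Part E — and the AH-Pairs hypothesis is not needed).
* **Theorem 2** (main result): "Assuming AH-Pairs, then for any sufficiently large even integer `M`
  and `T → ∞`, `2Σ_{j=1}^M (M − j)(P_{j−½}(T) + P_j(T) − (1 − 2/(π²(2j−1)²)))
  = (3/2 − P_0(T))M − Σ_{j=1}^M P_{j−½}(T) + O(√log M) + O(M²(R(T) + 1/L²))`." —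
  `glss2026_theorem2`, with the `√log M`-constant absolute and `R` the AH-Pairs function at level `M`.
* (AH1) "For any sufficiently large `T`, for each positive integer `j`,
  `P_{j−½}(T) + P_j(T) = 1 − 2/(π²(2j−1)²) + O(R_P(T))`, `R_P` positive decreasing `→ 0`" (error
  uniform in `j`, p. 4); (AH2) "for any large even integer `M`,
  `Σ_{j=1}^M P_{j−½}(T) = M/2 − 1/4 + O(1/M) + O(M R_P(T))`."
* **Theorem 3**: "Assuming AH-Pairs and (AH1): `3/2 − P_0(T) = (1/M)Σ_{j=1}^M P_{j−½}(T) +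
  O(√log M/M) + O(M(R(T) + R_P(T) + 1/L²))` and `P_0(T) − ½ = (1/M)Σ_{j=1}^M P_j(T) + (same)`." —
  `glss2026_theorem3`.
* **Theorem 4**: "Assuming AH-Pairs and AH-Weak Density, we have `p_0 = 1` and asymptotically 100%
  of the zeros of `ζ(s)` are simple and on the critical line." — `glss2026_theorem4`.
* **Corollary 2**: "Assuming AH-Pairs and (AH1), `limsup_{T→∞} P_0(T) ≤ 3/2` and asymptotically at
  least 50% of the zeros of `ζ(s)` are simple and at least 50% are on the critical line." —
  `glss2026_corollary2`.
* The unnumbered "Theorem" of p. 3 (RH ∧ AH-Pairs ⇒ the density constraints) is BGSTB 2025,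
  Theorem 1 = `bgstb2025_theorem1` (cited, not retyped); PCC = the tree's
  `MontgomeryPairCorrelation` (GLSS's `N(T, λ)` normalises by `TL` and opens the window at `0`; not
  needed by the statements below); SMC (N*) is not used below.
PROVED here: `GLSS2026.ahPairsAt_iff`, `GLSS2026.dens_eq_binDensity`, and (appended 2026-08-26,
discharge pass) the paper's two elementary deductions: **Theorem 4 from Theorem 3 and Corollary 1**
(`glss2026_theorem4_of_theorem3_of_corollary1`: with (AH2) in (thm3a), `P_0(T) = 1 + O(√log M/M) +
O(M(R + R_P + 1/L²))`, so `p_0 = 1`, then Corollary 1) and **Corollary 2's first half from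
Theorem 3** (`glss2026_corollary2_limsup_of_theorem3`: `P_{k/2} ≥ 0` in (thm3a)); and (Parts D–E)
Corollary 1 outright (`glss2026_corollary1_holds`), hence **Theorem 4 from Theorem 3 alone**
(`glss2026_theorem4_of_theorem3`), and (Part F) Corollary 2's zero-counting half from its density
half, hence **Corollary 2 from Theorem 3** (`glss2026_corollary2_of_theorem3`). Theorem 2 rests on [GLSS1] and the Gallagher–Mueller/Fujii–Tsang second-moment estimates
(Propositions 1–2) and stays a named fact; Theorem 1 is DISCHARGED (Part G), Theorem 3 is PROVED
modulo Theorem 2 (Part H), so Theorems 3–4 and Corollary 2 are typed facts PROVED modulo Theorem 2.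

## Part C — Aryan 2019, Theorem 1.1 (§1 p. 2, proof §3)

"The Alternative Hypothesis (AH) [formulation of Farmer, Gonek and Lee]. There exists a real number
`T₀` such that if `γ > T₀`, then `γ̃⁺ − γ̃ ∈ ½ℤ`", with the FGL normalisation
`γ̃ = (1/2π) γ log(γ/2π)` (NOT Montgomery's `γ log γ/2π` = tree `normalizedOrdinate`; kept
distinct: `Aryan2019.fglOrdinate`) and `γ⁺` the next ordinate — `Aryan2019.AH T₀`, a PREDICATE.
"Let `g_σ` denote the proportion of normalized gaps between consecutive zeros that are equal to
`σ`" — the source presupposes these proportions exist; we render "`g_σ` is the proportion" as the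
explicit hypothesis `Aryan2019.HasGapProportion σ g` (the counting ratio tends to `g`).
**Theorem 1.1** ("Assume the Riemann hypothesis and AH"): `g_{1.5} ≥ 0.1079271`;
`g_{1.5} ≥ 0.1 + 2(0.5 − g_1 + 0.0039635)`; for `k ≥ 2`, `g_k ≤ (0.18951 − 2(0.5 − g_1))/k`; (the
fourth item "if `g_1 = 4/π²` then `g_2, g_{2.5}, … ≈ 0`" is not a mathematical statement and is not
typed) — CLAIM `aryan2019_theorem11`. Its printed proof (§3) is a linear-programming deduction
from four inputs: `Σ_k g_k = 1`, `Σ_k k·g_k = 1` ("these gaps must cover the whole interval"),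
and Farmer–Gonek–Lee's `g_{0.5} = 0.5 − 2/π²`, `4/π² ≤ g_1 ≤ 0.5`; that deduction is PROVED here
as the RH-free, AH-free real-analysis lemma `Aryan2019.gapProportion_inequalities` (with the
sharper closed forms `6/π² − 1/2` and `1/2 + 6/π² − 2g_1`), so the claim's residual content is
exactly the four inputs.

## Part D — the two typings of ESH agree (identification, PROVED; appended 2026-08-26)

`GLSS2026.esh_iff_essentialSimplicityHypothesis : GLSS2026.ESH ↔ EssentialSimplicityHypothesis`,
unconditionally (no RH, no AH): the symmetric-window pair count of the tree's ESH splits as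
`N⊛(T) + 2N(T, α)` (`GLSS2026.pairCorrelationCount_neg_eq`), `N(T) ≤ N⊛(T)`, `N(T) ∼ TL`
(tree theorem `RudnickSarnak.tendsto_zetaZeroCount_div_main`, whence the import of
`RudnickSarnakPairSmoothed`), and (ES2) over all functions `λ₀ → 0` is uniformised by a diagonal
argument (`GLSS2026.ES2.exists_eventually_le`). With seat t5's unconditional
`essentialSimplicity_of_hasLimitingDensity_one` (`AlternativeHypothesisESHProofs.lean`) this PROVES
the direction "`p_0 = 1 ⇒ ESH`" of GLSS Theorem 1 with no AH-Pairs
(`glss2026_theorem1_mp_unconditional`); the converse direction stays inside the named fact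
`glss2026_theorem1`.

## Part E — (ES1) alone gives 100% simple zeros on the line; Corollary 1 DISCHARGED (appended 2026-08-26)

`GLSS2026.two_mul_zetaZeroCount_sub_coincidentPairCount_le : 2N(T) − N⊛(T) ≤ N⁽¹⁾(T)` for every
`T` (unconditional): by the tree's ordinate dictionary (`ZetaZeroBoxEnumeration.lean`)
`N⊛(T) = Σ_ρ m(ρ)c(Im ρ)` and `N(T) = Σ_ρ m(ρ)` over the distinct zeros of the box, where
`c(Im ρ) ≥ m(ρ)`, and `≥ 2m(ρ)` off the line (the reflected zero `1 − ρ̄`, same height and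
multiplicity, `riemannZetaZeroOrder_one_sub_conj`). Hence (ES1) ⇒ `N⁽¹⁾(T)/N(T) → 1`
(`GLSS2026.almostAllSimpleOnLine_of_ES1`), **`glss2026_corollary1_holds : glss2026_corollary1`**
(no AH-Pairs used), `glss2026_theorem4_of_theorem3`, and the unconditional
`GLSS2026.almostAllSimpleOnLine_of_hasLimitingDensity_one` /
`GLSS2026.almostAllSimpleOnLine_of_essentialSimplicityHypothesis`.

## Part F — `limsup P_0 ≤ 3/2` gives 50% simple zeros on the line; Corollary 2 from Theorem 3 (appended 2026-08-26)

`GLSS2026.exists_coincidentPairCount_le_bin_add : N⊛(T) ≤ |B_0(T, M, δ)| + C·T` for large `T`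
(coincident pairs above `T/log²T` lie in the diagonal bin, the rest are `O(T)` by the local density
of zeros — the tree lemmas `AH.card_pairs_offWindow_le`, `AH.exists_zetaZeroCount_le_mul_log` of
`AlternativeHypothesisESHProofs.lean`), so `limsup P_0(T) ≤ 3/2` gives, with Part E,
`N⁽¹⁾(T) ≥ (1/2 − ε)N(T)` eventually (`GLSS2026.eventually_simpleCritical_ge_of_dens_le`) and
`GLSS2026.HalfSimpleHalfOnLine` (`N_s, N_0 ≥ N⁽¹⁾`; `simpleCriticalZeroCount_le_criticalZeroCount` is
the tree's, whence the import of `ZeroCountingLevinsonProofs`). Hence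
`glss2026_corollary2_of_theorem3 : glss2026_theorem3 → glss2026_corollary2`.

## Part G — Theorem 1 DISCHARGED (appended 2026-08-26)

`glss2026_theorem1_holds : glss2026_theorem1`: the direction ESH ⇒ `p_0 = 1` under AH-Pairs by the
printed proof of §2 — AH-Pairs localises the diagonal bin (`B_0(T, M, ½)` = the pairs of `𝒫(T, M)`
within `|C|R(T)` of `0`, `GLSS2026.eventually_abs_pairSpacing_le_of_mem_bin_zero`), so
`N⊛(T) − O(T) ≤ |B_0| ≤ N⊛(T) + 2N(T, |C|R(T))` and (ES1), (ES2) give `P_0(T, M, ½) → 1`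
(`GLSS2026.tendsto_binDensity_zero_of_esh`); the converse is Part D.

## Part H — Theorem 3 from Theorem 2 (appended 2026-08-26)

`glss2026_theorem3_of_theorem2 : glss2026_theorem2 → glss2026_theorem3` (substitute (AH1) into
Theorem 2, divide by `M`; (thm3b) via (averageP)), hence `glss2026_theorem4_of_theorem2`,
`glss2026_corollary2_of_theorem2`: Theorems 1, 3, 4 and Corollaries 1, 2 are theorems of the tree
modulo the single named fact `glss2026_theorem2`.

## References

* [GoldstonLeeSchettlerSuriajaya2026] as above, §§1–2, 4.
* [Aryan2019] as above, §1 Theorem 1.1, §3.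
* [BaluyotGoldstonSuriajayaTurnageButterbaugh2025] arXiv:2508.10857, §1 (AH-Pairs, `𝒫`, `B_{k/2}`,
  `P_{k/2}`), for Part B; Theorem 2 ("and thus ESH") for Part D.
* [Ivic2002SmallValues] (32)–(33) and [Mueller1983] (the tree's `EssentialSimplicityHypothesis`),
  [Titchmarsh1986] Thm. 9.4 (`N(T) ∼ (T/2π) log T`), §9.1 (ordinates with multiplicity), §2.12
  (reflected zeros), for Parts D–E.
* [Montgomery1973] (the tree's `pairCorrelationCount`, `zeroIndexSet`); §3 (the multiplicity count
  behind Part E).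
-/

noncomputable section

open Filter Real
open scoped Topology

namespace Literature.NumberTheory.LFunctions

/-! ## Part A: GLSS 2026, §1 — the paper's counting functions and its ESH -/

namespace GLSS2026

/-- `L = L(T) := (1/2π) log T`, the density of zeros at height `T` (GLSS 2026, (N(T)):
"`N(T) ∼ TL`, where `L := (1/2π) log T`"). [cite: GoldstonLeeSchettlerSuriajaya2026, §1 eq. (1.1)] -/
def L (T : ℝ) : ℝ :=
  Real.log T / (2 * π)

open scoped Classical in
/-- **`N(T, λ)`**, the pair-correlation counting function of GLSS 2026, (N(T,U)):
`#{(ρ, ρ') : 0 < γ, γ' ≤ T, 0 < (γ − γ')L ≤ λ}`, pairs of zeros counted with multiplicity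
(pairs of indices in `zeroIndexSet T`), "the height of the second zero is greater than the first
by at most `λ/L`" (strictly greater: the diagonal and coincident ordinates are excluded).
[cite: GoldstonLeeSchettlerSuriajaya2026, §1 eq. (1.2)] -/
def pairCount (T lam : ℝ) : ℕ :=
  ((zeroIndexSet T ×ˢ zeroIndexSet T).filter fun p ↦
    0 < (zetaOrdinate p.1 - zetaOrdinate p.2) * L T ∧
      (zetaOrdinate p.1 - zetaOrdinate p.2) * L T ≤ lam).card

open scoped Classical in
/-- **`N⊛(T)`** of GLSS 2026 (display before (ES1)): `#{(ρ, ρ') : 0 < γ, γ' ≤ T, γ = γ'}`, pairs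
counted with multiplicity — the diagonal weight of the pair correlation without RH (distinct
zeros on one horizontal line also contribute). [cite: GoldstonLeeSchettlerSuriajaya2026, §1 (definition of N⊛ before (ES1))] -/
def coincidentPairCount (T : ℝ) : ℕ :=
  ((zeroIndexSet T ×ˢ zeroIndexSet T).filter fun p ↦ zetaOrdinate p.1 = zetaOrdinate p.2).card

/-- `N⊛(T)` is the tree's pair-correlation count on the degenerate window `[0, 0]`:
`coincidentPairCount T = pairCorrelationCount 0 0 T`. [cite: GoldstonLeeSchettlerSuriajaya2026, §1 (definition of N⊛)] -/
theorem coincidentPairCount_eq_pairCorrelationCount (T : ℝ) :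
    coincidentPairCount T = pairCorrelationCount 0 0 T := by
  classical
  unfold coincidentPairCount pairCorrelationCount
  congr 1
  refine Finset.filter_congr fun p _ ↦ ?_
  simp only [mul_zero, zero_div]
  constructor
  · intro h
    simp [h]
  · rintro ⟨h1, h2⟩
    linarith

/-- **(ES1)** of GLSS 2026: `N⊛(T) = TL + o(TL)` as `T → ∞`, i.e. `N⊛(T)/(TL) → 1`. A PREDICATE
(part of the hypothesis ESH), never asserted. [cite: GoldstonLeeSchettlerSuriajaya2026, §1 (ES1)] -/
def ES1 : Prop :=
  Tendsto (fun T : ℝ ↦ (coincidentPairCount T : ℝ) / (T * L T)) atTop (𝓝 1)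

/-- **(ES2)** of GLSS 2026: "`N(T, λ₀) = o(TL)` if `λ₀ → 0` as `T → ∞`" — for every function
`λ₀ = λ₀(T) → 0`, `N(T, λ₀(T))/(TL) → 0`. A PREDICATE. [cite: GoldstonLeeSchettlerSuriajaya2026, §1 (ES2)] -/
def ES2 : Prop :=
  ∀ lam₀ : ℝ → ℝ, Tendsto lam₀ atTop (𝓝 0) →
    Tendsto (fun T : ℝ ↦ (pairCount T (lam₀ T) : ℝ) / (T * L T)) atTop (𝓝 0)

/-- **Essential Simplicity Hypothesis (ESH)** in the precise form of GLSS 2026 (from [GLSS1]):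
(ES1) and (ES2). A PREDICATE consumed as a hypothesis or a conclusion; not the informal ESH
sentence of Baluyot–Goldston–Suriajaya–Turnage-Butterbaugh 2025 (no identification is made).
[cite: GoldstonLeeSchettlerSuriajaya2026, §1 (ESH = (ES1) ∧ (ES2))] -/
def ESH : Prop :=
  ES1 ∧ ES2

/-- "Asymptotically 100% of the zeros of `ζ(s)` are simple and on the critical line" (the
conclusion of GLSS 2026, Corollary 1 and Theorem 4): the simple zeros on the critical line
(tree `simpleCriticalZeroCount`, each such zero has multiplicity one) have density one among all
zeros counted with multiplicity, `N⁽¹⁾(T)/N(T) → 1`. A PREDICATE (conclusion shape).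
[cite: GoldstonLeeSchettlerSuriajaya2026, §1 Corollary 1] -/
def AlmostAllSimpleOnLine : Prop :=
  Tendsto (fun T : ℝ ↦ (simpleCriticalZeroCount T : ℝ) / zetaZeroCount T) atTop (𝓝 1)

/-- "Asymptotically at least 50% of the zeros of `ζ(s)` are simple and at least 50% are on the
critical line" (the conclusion of GLSS 2026, Corollary 2, proof §4: `N_s(T) ≥ (1/2 + o(1)) N(T)`
and `N_0(T) ≥ (1/2 + o(1)) N(T)`, with `N_s` = tree `simpleZeroCount` (simple zeros anywhere in
the strip) and `N_0` = tree `criticalZeroCount` (zeros on the line, with multiplicity)): for every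
`ε > 0`, eventually `(1/2 − ε) N(T) ≤ N_s(T)` and `(1/2 − ε) N(T) ≤ N_0(T)`. A PREDICATE.
[cite: GoldstonLeeSchettlerSuriajaya2026, §1 Corollary 2 and §4 (N_s, N_0)] -/
def HalfSimpleHalfOnLine : Prop :=
  ∀ ε : ℝ, 0 < ε → ∀ᶠ T : ℝ in atTop,
    (1 / 2 - ε) * (zetaZeroCount T : ℝ) ≤ simpleZeroCount T ∧
      (1 / 2 - ε) * (zetaZeroCount T : ℝ) ≤ criticalZeroCount T

/-! ## Part B: GLSS 2026 — AH-Pairs data, the `δ = 1/2` densities, the model (AH1)/(AH2) -/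

/-- **The data of AH-Pairs at level `M`, unbundled**: a positive non-increasing `R(T) → 0` and a
constant `C` such that for all large `T` every pair in `𝒫(T, M)` is within `C(|k| + 1)R(T)` of a
half-integer `k/2` (GLSS (AH0) = BGSTB (AH2k)). `AHPairsAt M ↔ ∃ R C, IsAHPairsWitness M R C`
(`ahPairsAt_iff`); the unbundled form lets Theorems 2–3 name `R` in their error terms.
[cite: GoldstonLeeSchettlerSuriajaya2026, §1 (AH0)] -/
def IsAHPairsWitness (M : ℝ) (R : ℝ → ℝ) (C : ℝ) : Prop :=
  (∀ T, 0 < R T) ∧ Antitone R ∧ Tendsto R atTop (𝓝 0) ∧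
    ∀ᶠ T : ℝ in atTop, ∀ p ∈ AH.pairs T M, ∃ k : ℤ,
      |AH.pairSpacing T p - (k : ℝ) / 2| ≤ C * (|(k : ℝ)| + 1) * R T

/-- `AHPairsAt M` (seat t5, BGSTB (AH-Pairs) at level `M`) is the existence of such data.
[cite: GoldstonLeeSchettlerSuriajaya2026, §1 (AH0)] -/
theorem ahPairsAt_iff (M : ℝ) : AHPairsAt M ↔ ∃ (R : ℝ → ℝ) (C : ℝ), IsAHPairsWitness M R C := by
  constructor
  · rintro ⟨R, h0, ha, ht, C, hC⟩
    exact ⟨R, C, h0, ha, ht, hC⟩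
  · rintro ⟨R, C, h0, ha, ht, hC⟩
    exact ⟨R, h0, ha, ht, C, hC⟩

/-- **GLSS's density `P_{k/2}(T)`** (δ = 1/2, window `k/2 ∓ 1/4`, (1.10)–(1.11)) as an `M`-free
number: BGSTB's `P_{k/2}(T, M, 1/2)` at the level `M = (|k| + ½)/2`, from which on it no longer
depends on `M` (`dens_eq_binDensity`). [cite: GoldstonLeeSchettlerSuriajaya2026, §1 eq. (1.11)] -/
def dens (k : ℤ) (T : ℝ) : ℝ :=
  AH.binDensity k T ((|(k : ℝ)| + 1 / 2) / 2) (1 / 2)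

/-- `P_{k/2}(T) = P_{k/2}(T, M, 1/2)` for every `M ≥ (|k| + ½)/2`. [cite: GoldstonLeeSchettlerSuriajaya2026, §1 eq. (1.11)] -/
theorem dens_eq_binDensity {k : ℤ} {T M : ℝ} (hM : (|(k : ℝ)| + 1 / 2) / 2 ≤ M) :
    dens k T = AH.binDensity k T M (1 / 2) :=
  AH.binDensity_eq_binDensity_of_le le_rfl hM

/-- **(AH1)** of GLSS 2026 (the model, p. 4): "For any sufficiently large `T`, we have for each
positive integer `j`, `P_{j−½}(T) + P_j(T) = 1 − 2/(π²(2j−1)²) + O(R_P(T))`, where `R_P(T)` is a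
positive decreasing function with `R_P(T) → 0`" — the error NOT depending on `j` ("unlike in
(AH2k), the error in (AH1) should not depend on `j`"). With the `M`-free densities `dens`. A
HYPOTHESIS formulated by the source, typed as a predicate on `R_P`, never asserted.
[cite: GoldstonLeeSchettlerSuriajaya2026, §1 (AH1)] -/
def AH1 (R_P : ℝ → ℝ) : Prop :=
  (∀ T, 0 < R_P T) ∧ Antitone R_P ∧ Tendsto R_P atTop (𝓝 0) ∧
    ∃ C : ℝ, ∀ᶠ T : ℝ in atTop, ∀ j : ℕ, 1 ≤ j →
      |dens (2 * j - 1) T + dens (2 * j) T - (1 - 2 / (π ^ 2 * (2 * (j : ℝ) - 1) ^ 2))| ≤ C * R_P T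

/-- **(AH2)** of GLSS 2026 (the model, p. 4): "for any large even integer `M`,
`Σ_{j=1}^M P_{j−½}(T) = M/2 − 1/4 + O(1/M) + O(M R_P(T))`" (same `R_P` as in (AH1); constants
uniform in `M` — the reading used by the paper's "since we can take `M` as large as we wish,
`p_0 = 1`" in the deduction of Theorem 4; the source's side remark "uniform in `M` on any interval
`0 < m₁ ≤ M ≤ m₂ < ∞`" concerns the `T`-threshold). A HYPOTHESIS formulated by the source, typed as
a predicate, never asserted. [cite: GoldstonLeeSchettlerSuriajaya2026, §1 (AH2)] -/
def AH2 (R_P : ℝ → ℝ) : Prop :=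
  ∃ C : ℝ, ∃ M₀ : ℕ, ∀ M : ℕ, M₀ ≤ M → Even M → ∀ᶠ T : ℝ in atTop,
    |∑ j ∈ Finset.Icc 1 M, dens (2 * (j : ℤ) - 1) T - ((M : ℝ) / 2 - 1 / 4)| ≤
      C / M + C * M * R_P T

/-- **AH-Weak Density** (GLSS 2026, the hypothesis block [AH_Weak] = (AH1) ∧ (AH2) with a common
`R_P`, as assumed in Theorem 4). A HYPOTHESIS, typed as a predicate, never asserted.
[cite: GoldstonLeeSchettlerSuriajaya2026, §1 (AH1)–(AH2)] -/
def AHWeakDensity : Prop :=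
  ∃ R_P : ℝ → ℝ, AH1 R_P ∧ AH2 R_P

end GLSS2026

/-! ## Part B (continued): GLSS 2026, Theorems 1–4 and Corollaries 1–2 (named facts; refereed) -/

/-- **GLSS 2026, Theorem 1**: "Assuming AH-Pairs, we have that `p_0 = 1` is equivalent to ESH."
(`p_0` with GLSS's window `∓1/4`, i.e. `AH.HasLimitingDensity 0 (1/2) 1`; ESH = `GLSS2026.ESH`.)
Named fact; DISCHARGED in Part G (`glss2026_theorem1_holds`). [cite: GoldstonLeeSchettlerSuriajaya2026, Theorem 1] -/
def glss2026_theorem1 : Prop :=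
  AHPairs → (AH.HasLimitingDensity 0 (1 / 2) 1 ↔ GLSS2026.ESH)

/-- **GLSS 2026, Corollary 1**: "Assuming AH-Pairs, if `p_0 = 1`, then asymptotically 100% of the
zeros of `ζ(s)` are simple and on the critical line." Named fact.
[cite: GoldstonLeeSchettlerSuriajaya2026, Corollary 1] -/
def glss2026_corollary1 : Prop :=
  AHPairs → AH.HasLimitingDensity 0 (1 / 2) 1 → GLSS2026.AlmostAllSimpleOnLine

/-- **GLSS 2026, Theorem 2** (main result): "Assuming AH-Pairs, then for any sufficiently large even
integer `M` and `T → ∞`, we have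
`2 Σ_{j=1}^M (M − j)(P_{j−½}(T) + P_j(T) − (1 − 2/(π²(2j−1)²)))
 = (3/2 − P_0(T)) M − Σ_{j=1}^M P_{j−½}(T) + O(√log M) + O(M²(R(T) + 1/L²))`."
Rendered: there are an absolute `A` and `M₀` such that for every even `M ≥ M₀` and every AH-Pairs
datum `(R, C)` at level `M` there is `A'` with, for all large `T`,
`|LHS − RHS| ≤ A √(log M) + A' M² (R(T) + 1/L²)` (densities `P_{k/2}(T) = P_{k/2}(T, M, ½)` at the
theorem's level `M`, as in the proof's partition of `𝒫(T, M)`). Named fact.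
[cite: GoldstonLeeSchettlerSuriajaya2026, Theorem 2] -/
def glss2026_theorem2 : Prop :=
  ∃ A : ℝ, ∃ M₀ : ℕ, ∀ M : ℕ, M₀ ≤ M → Even M → ∀ (R : ℝ → ℝ) (C : ℝ),
    GLSS2026.IsAHPairsWitness M R C → ∃ A' : ℝ, ∀ᶠ T : ℝ in atTop,
      |2 * ∑ j ∈ Finset.Icc 1 M, ((M : ℝ) - j) *
            (AH.binDensity (2 * (j : ℤ) - 1) T M (1 / 2) + AH.binDensity (2 * (j : ℤ)) T M (1 / 2) -
              (1 - 2 / (π ^ 2 * (2 * (j : ℝ) - 1) ^ 2))) -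
          ((3 / 2 - AH.binDensity 0 T M (1 / 2)) * M -
            ∑ j ∈ Finset.Icc 1 M, AH.binDensity (2 * (j : ℤ) - 1) T M (1 / 2))| ≤
        A * Real.sqrt (Real.log M) + A' * (M : ℝ) ^ 2 * (R T + 1 / GLSS2026.L T ^ 2)

/-- **GLSS 2026, Theorem 3**: "Assuming AH-Pairs and (AH1), we have
`3/2 − P_0(T) = (1/M) Σ_{j=1}^M P_{j−½}(T) + O(√log M/M) + O(M(R(T) + R_P(T) + 1/L²))` and
`P_0(T) − ½ = (1/M) Σ_{j=1}^M P_j(T) + O(√log M/M) + O(M(R(T) + R_P(T) + 1/L²))`."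
Same quantifier shape as Theorem 2. Named fact; PROVED modulo Theorem 2 in Part H
(`glss2026_theorem3_of_theorem2`). [cite: GoldstonLeeSchettlerSuriajaya2026, Theorem 3] -/
def glss2026_theorem3 : Prop :=
  ∃ A : ℝ, ∃ M₀ : ℕ, ∀ M : ℕ, M₀ ≤ M → Even M → ∀ (R : ℝ → ℝ) (C : ℝ),
    GLSS2026.IsAHPairsWitness M R C → ∀ R_P : ℝ → ℝ, GLSS2026.AH1 R_P → ∃ A' : ℝ, ∀ᶠ T : ℝ in atTop,
      |(3 / 2 - AH.binDensity 0 T M (1 / 2)) -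
            (∑ j ∈ Finset.Icc 1 M, AH.binDensity (2 * (j : ℤ) - 1) T M (1 / 2)) / M| ≤
          A * Real.sqrt (Real.log M) / M + A' * M * (R T + R_P T + 1 / GLSS2026.L T ^ 2) ∧
        |(AH.binDensity 0 T M (1 / 2) - 1 / 2) -
            (∑ j ∈ Finset.Icc 1 M, AH.binDensity (2 * (j : ℤ)) T M (1 / 2)) / M| ≤
          A * Real.sqrt (Real.log M) / M + A' * M * (R T + R_P T + 1 / GLSS2026.L T ^ 2)

/-- **GLSS 2026, Theorem 4**: "Assuming AH-Pairs and AH-Weak Density, we have `p_0 = 1` and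
asymptotically 100% of the zeros of `ζ(s)` are simple and on the critical line." Named fact.
[cite: GoldstonLeeSchettlerSuriajaya2026, Theorem 4] -/
def glss2026_theorem4 : Prop :=
  AHPairs → GLSS2026.AHWeakDensity →
    AH.HasLimitingDensity 0 (1 / 2) 1 ∧ GLSS2026.AlmostAllSimpleOnLine

/-- **GLSS 2026, Corollary 2**: "Assuming AH-Pairs and (AH1), we have `limsup_{T→∞} P_0(T) ≤ 3/2`
and asymptotically at least 50% of the zeros of `ζ(s)` are simple and at least 50% are on the
critical line." (`P_0(T)` is `M`-free: `GLSS2026.dens 0 T`.) Named fact.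
[cite: GoldstonLeeSchettlerSuriajaya2026, Corollary 2] -/
def glss2026_corollary2 : Prop :=
  AHPairs → (∃ R_P : ℝ → ℝ, GLSS2026.AH1 R_P) →
    (∀ ε : ℝ, 0 < ε → ∀ᶠ T : ℝ in atTop, GLSS2026.dens 0 T ≤ 3 / 2 + ε) ∧
      GLSS2026.HalfSimpleHalfOnLine

/-- Theorem 4's first conclusion feeds Corollary 1: modulo the two facts, AH-Pairs and AH-Weak
Density give 100% simple zeros on the line by the route the paper states ("Thus by Corollary 1 …").
[cite: GoldstonLeeSchettlerSuriajaya2026, Theorem 4 (proof sketch before the statement)] -/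
theorem glss2026_almostAll_of_theorem4_density (h1 : glss2026_corollary1)
    (h4 : AHPairs → GLSS2026.AHWeakDensity → AH.HasLimitingDensity 0 (1 / 2) 1)
    (hAH : AHPairs) (hW : GLSS2026.AHWeakDensity) : GLSS2026.AlmostAllSimpleOnLine :=
  h1 hAH (h4 hAH hW)

/-! ## Part B discharges: Theorem 4 from Theorem 3 and Corollary 1; Corollary 2 (first half)
from Theorem 3 -/

namespace GLSS2026

/-- `1/L(T)² → 0` as `T → ∞` (`L = log T/2π → ∞`). [cite: GoldstonLeeSchettlerSuriajaya2026, §1 eq. (1.1)] -/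
theorem tendsto_inv_L_sq : Tendsto (fun T : ℝ ↦ 1 / L T ^ 2) atTop (𝓝 0) := by
  have hL : Tendsto L atTop atTop :=
    (Real.tendsto_log_atTop.atTop_div_const (by positivity : (0 : ℝ) < 2 * π))
  have h2 : Tendsto (fun T ↦ L T ^ 2) atTop atTop := (tendsto_pow_atTop two_ne_zero).comp hL
  have h3 := tendsto_inv_atTop_zero.comp h2
  refine h3.congr fun T ↦ ?_
  simp [one_div]

/-- `√(log M)/M → 0` along the natural numbers. [folklore] -/
private theorem tendsto_sqrt_log_div : Tendsto (fun M : ℕ ↦ Real.sqrt (Real.log M) / M) atTop (𝓝 0) := by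
  -- squeeze between `0` and `(log x + 1)/x`
  have h1 : Tendsto (fun x : ℝ ↦ Real.log x ^ 1 / (1 * x + 0)) atTop (𝓝 0) :=
    Real.tendsto_pow_log_div_mul_add_atTop 1 0 1 one_ne_zero
  have h2 : Tendsto (fun x : ℝ ↦ x⁻¹) atTop (𝓝 0) := tendsto_inv_atTop_zero
  have h3 : Tendsto (fun x : ℝ ↦ Real.log x ^ 1 / (1 * x + 0) + x⁻¹) atTop (𝓝 0) := by
    simpa using h1.add h2
  have hreal : Tendsto (fun x : ℝ ↦ Real.sqrt (Real.log x) / x) atTop (𝓝 0) := by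
    refine tendsto_of_tendsto_of_tendsto_of_le_of_le' tendsto_const_nhds h3 ?_ ?_
    · filter_upwards [eventually_ge_atTop 1] with x hx
      exact div_nonneg (Real.sqrt_nonneg _) (by linarith)
    · filter_upwards [eventually_ge_atTop 1] with x hx
      have hlog : 0 ≤ Real.log x := Real.log_nonneg hx
      have hsq : Real.sqrt (Real.log x) ≤ Real.log x + 1 := by
        rw [Real.sqrt_le_left (by linarith)]
        nlinarith
      have hx0 : 0 < x := by linarith
      calc Real.sqrt (Real.log x) / x ≤ (Real.log x + 1) / x := by gcongr
        _ = Real.log x ^ 1 / (1 * x + 0) + x⁻¹ := by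
          field_simp
          ring
  exact hreal.comp tendsto_natCast_atTop_atTop

end GLSS2026

/-- **Theorem 4 from Theorem 3 and Corollary 1 (the printed deduction, PROVED).** GLSS: "If in
Theorem 3 we also assume (AH2), then by using (AH2) in (thm3a) … we immediately obtain
`P_0(T) = 1 + O(√log M/M) + O(M(R(T) + R_P(T) + 1/L²))`. Thus `p_0 = 1 + O(√log M/M)`, and since
we can take `M` as large as we wish, we have obtained `p_0 = 1`. Thus by Corollary 1 …". Modulo
the two named facts `glss2026_theorem3`, `glss2026_corollary1`, Theorem 4 is a theorem.
[cite: GoldstonLeeSchettlerSuriajaya2026, Theorem 4 (deduction before the statement)] -/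
theorem glss2026_theorem4_of_theorem3_of_corollary1 (h3 : glss2026_theorem3)
    (h1 : glss2026_corollary1) : glss2026_theorem4 := by
  intro hAH hW
  suffices hp : AH.HasLimitingDensity 0 (1 / 2) 1 from ⟨hp, h1 hAH hp⟩
  obtain ⟨R_P, hAH1, C₂, M₀', hAH2⟩ := hW
  have hRP : Tendsto R_P atTop (𝓝 0) := hAH1.2.2.1
  have hRPpos : ∀ T, 0 < R_P T := hAH1.1
  obtain ⟨A, M₀, hA⟩ := h3
  rw [AH.hasLimitingDensity_iff]
  have hgoal : (fun T : ℝ ↦ AH.binDensity 0 T ((|((0 : ℤ) : ℝ)| + 1 / 2) / 2) (1 / 2)) =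
      fun T ↦ GLSS2026.dens 0 T := by
    funext T; rfl
  rw [hgoal, Metric.tendsto_nhds]
  intro ε hε
  -- choose a large even `M`
  have hM1 : ∀ᶠ M : ℕ in atTop, |A| * (Real.sqrt (Real.log M) / M) ≤ ε / 4 := by
    have := (GLSS2026.tendsto_sqrt_log_div.const_mul |A|)
    rw [mul_zero] at this
    exact (this.eventually (ge_mem_nhds (by positivity : (0:ℝ) < ε / 4))) |>.mono fun M hM ↦ hM
  have hM2 : ∀ᶠ M : ℕ in atTop, (1 / 4 + |C₂|) / (M : ℝ) ≤ ε / 4 := by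
    have : Tendsto (fun M : ℕ ↦ (1 / 4 + |C₂|) / (M : ℝ)) atTop (𝓝 0) :=
      tendsto_const_nhds.div_atTop tendsto_natCast_atTop_atTop
    exact (this.eventually (ge_mem_nhds (by positivity : (0:ℝ) < ε / 4))) |>.mono fun M hM ↦ hM
  obtain ⟨M₁, hM₁⟩ := (hM1.and (hM2.and (eventually_ge_atTop (max (max M₀ M₀') 1)))).exists_forall_of_atTop
  -- take `M = 2 M₁`
  set M : ℕ := 2 * M₁ with hMdef
  have hM₁le : M₁ ≤ M := by omega
  obtain ⟨hMa, hMb, hMc⟩ := hM₁ M hM₁le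
  have hMM₀ : M₀ ≤ M := le_trans (le_trans (le_max_left _ _) (le_max_left _ _)) hMc
  have hMM₀' : M₀' ≤ M := le_trans (le_trans (le_max_right _ _) (le_max_left _ _)) hMc
  have hM1' : 1 ≤ M := le_trans (le_max_right _ _) hMc
  have hMeven : Even M := ⟨M₁, by omega⟩
  have hMpos : (0 : ℝ) < M := by exact_mod_cast hM1'
  -- AH-Pairs data at level `M`
  obtain ⟨R, C, hRC⟩ := (GLSS2026.ahPairsAt_iff (M : ℝ)).mp (hAH M hMpos)
  have hR : Tendsto R atTop (𝓝 0) := hRC.2.2.1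
  obtain ⟨A', hT3⟩ := hA M hMM₀ hMeven R C hRC R_P hAH1
  have hT2 := hAH2 M hMM₀' hMeven
  -- the `T`-dependent error tends to zero
  have herr : Tendsto (fun T : ℝ ↦ |C₂| * R_P T +
      |A'| * M * (R T + R_P T + 1 / GLSS2026.L T ^ 2)) atTop (𝓝 0) := by
    have e1 : Tendsto (fun T : ℝ ↦ |C₂| * R_P T) atTop (𝓝 0) := by
      simpa using hRP.const_mul |C₂|
    have e2 : Tendsto (fun T : ℝ ↦ |A'| * M * (R T + R_P T + 1 / GLSS2026.L T ^ 2))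
        atTop (𝓝 0) := by
      simpa using ((hR.add hRP).add GLSS2026.tendsto_inv_L_sq).const_mul (|A'| * M)
    simpa using e1.add e2
  have hsmall : ∀ᶠ T : ℝ in atTop, |C₂| * R_P T +
      |A'| * M * (R T + R_P T + 1 / GLSS2026.L T ^ 2) < ε / 4 := by
    filter_upwards [(Metric.tendsto_nhds.mp herr) (ε / 4) (by positivity)] with T hT
    rw [Real.dist_eq, sub_zero] at hT
    exact lt_of_abs_lt hT
  filter_upwards [hT3, hT2, hsmall] with T h3T h2T hsT
  obtain ⟨h3a, -⟩ := h3T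
  -- identify the level-`M` densities with the `M`-free ones
  have hM1r : (1 : ℝ) ≤ M := by exact_mod_cast hM1'
  have hP0 : AH.binDensity 0 T M (1 / 2) = GLSS2026.dens 0 T :=
    (GLSS2026.dens_eq_binDensity (by norm_num; linarith)).symm
  have hS : ∑ j ∈ Finset.Icc 1 M, AH.binDensity (2 * (j : ℤ) - 1) T M (1 / 2) =
      ∑ j ∈ Finset.Icc 1 M, GLSS2026.dens (2 * (j : ℤ) - 1) T := by
    refine Finset.sum_congr rfl fun j hj ↦ ?_
    rw [Finset.mem_Icc] at hj
    refine (GLSS2026.dens_eq_binDensity ?_).symm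
    have hj1 : (1 : ℝ) ≤ j := by exact_mod_cast hj.1
    have hj2 : (j : ℝ) ≤ M := by exact_mod_cast hj.2
    have habs : |((2 * (j : ℤ) - 1 : ℤ) : ℝ)| = 2 * (j : ℝ) - 1 := by
      rw [show ((2 * (j : ℤ) - 1 : ℤ) : ℝ) = 2 * (j : ℝ) - 1 by push_cast; ring]
      exact abs_of_nonneg (by linarith)
    rw [habs]; linarith
  rw [hP0, hS] at h3a
  -- abbreviations
  set P : ℝ := GLSS2026.dens 0 T with hP
  set S : ℝ := ∑ j ∈ Finset.Icc 1 M, GLSS2026.dens (2 * (j : ℤ) - 1) T with hSdef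
  set E : ℝ := R T + R_P T + 1 / GLSS2026.L T ^ 2 with hE
  have hE0 : 0 ≤ E := by
    have := (hRC.1 T).le; have := (hRPpos T).le
    positivity
  have hRP0 : 0 ≤ R_P T := (hRPpos T).le
  have hMinv : (0 : ℝ) < 1 / M := by positivity
  have hMinv1 : 1 / (M : ℝ) ≤ 1 := by
    rw [div_le_one hMpos]; exact hM1r
  -- (thm3a): `|(3/2 − P) − S/M| ≤ |A| √log M/M + |A'| M E`
  have h3' : |(3 / 2 - P) - S / M| ≤ |A| * (Real.sqrt (Real.log M) / M) + |A'| * M * E := by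
    refine h3a.trans (add_le_add ?_ ?_)
    · rw [mul_div_assoc]
      exact mul_le_mul_of_nonneg_right (le_abs_self A)
        (div_nonneg (Real.sqrt_nonneg _) hMpos.le)
    · exact mul_le_mul_of_nonneg_right (mul_le_mul_of_nonneg_right (le_abs_self A') hMpos.le) hE0
  -- (AH2) divided by `M`: `|S/M − (1/2 − (1/4)(1/M))| ≤ |C₂|/M² + |C₂| R_P`
  have h2' : |S / M - (1 / 2 - 1 / 4 * (1 / M))| ≤
      |C₂| * (1 / M) * (1 / M) + |C₂| * R_P T := by
    have hrew : S / M - (1 / 2 - 1 / 4 * (1 / M)) = (S - ((M : ℝ) / 2 - 1 / 4)) * (1 / M) := by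
      field_simp
    rw [hrew, abs_mul, abs_of_pos hMinv]
    calc |S - ((M : ℝ) / 2 - 1 / 4)| * (1 / M) ≤ (C₂ / M + C₂ * M * R_P T) * (1 / M) := by
          gcongr
      _ = C₂ * (1 / M) * (1 / M) + C₂ * R_P T := by
          field_simp
      _ ≤ |C₂| * (1 / M) * (1 / M) + |C₂| * R_P T := by
          gcongr <;> exact le_abs_self C₂
  -- assemble: `P − 1 = (1/4)(1/M) − (S/M − (1/2 − (1/4)(1/M))) − ((3/2 − P) − S/M)`
  have hid : P - 1 =
      1 / 4 * (1 / M) - (S / M - (1 / 2 - 1 / 4 * (1 / M))) - ((3 / 2 - P) - S / M) := by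
    ring
  rw [Real.dist_eq, hid]
  have hb1 := abs_le.mp h3'
  have hb2 := abs_le.mp h2'
  have hMb' : 1 / 4 * (1 / (M : ℝ)) + |C₂| * (1 / M) ≤ ε / 4 := by
    have : (1 / 4 + |C₂|) / (M : ℝ) = 1 / 4 * (1 / M) + |C₂| * (1 / M) := by ring
    linarith [this]
  have hC₂sq : |C₂| * (1 / (M : ℝ)) * (1 / M) ≤ |C₂| * (1 / M) :=
    mul_le_of_le_one_right (mul_nonneg (abs_nonneg _) hMinv.le) hMinv1
  rw [abs_lt]
  constructor <;> linarith [hb1.1, hb1.2, hb2.1, hb2.2, hMa, hMb', hsT, hC₂sq, hMinv.le]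

/-- The densities `P_{k/2}(T, M, δ)` are non-negative for `T > 1` (a count divided by
`(T/2π) log T > 0`). [cite: GoldstonLeeSchettlerSuriajaya2026, §1 eq. (1.11)] -/
theorem GLSS2026.binDensity_nonneg (k : ℤ) {T : ℝ} (hT : 1 < T) (M δ : ℝ) :
    0 ≤ AH.binDensity k T M δ := by
  unfold AH.binDensity
  have hlog : 0 < Real.log T := Real.log_pos hT
  positivity

/-- **Corollary 2, first half, from Theorem 3 (the printed deduction, PROVED).** GLSS, proof of
Corollary 2: "by (thm3a) and `P_{k/2}(T) ≥ 0` we have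
`P_0(T) ≤ P_0(T) + (1/M)Σ P_{j−½}(T) = 3/2 + O(√log M/M) + O(M(R(T) + R_P(T) + 1/L²))`. Thus
`limsup_{T→∞} P_0(T) ≤ 3/2 + O(√log M/M)`, and thus `P_0(T) ≤ 3/2 + o(1)` because `M` can be
taken as large as we wish." Modulo the named fact `glss2026_theorem3`.
[cite: GoldstonLeeSchettlerSuriajaya2026, Corollary 2 (proof, §4)] -/
theorem glss2026_corollary2_limsup_of_theorem3 (h3 : glss2026_theorem3) (hAH : AHPairs)
    (hW : ∃ R_P : ℝ → ℝ, GLSS2026.AH1 R_P) :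
    ∀ ε : ℝ, 0 < ε → ∀ᶠ T : ℝ in atTop, GLSS2026.dens 0 T ≤ 3 / 2 + ε := by
  intro ε hε
  obtain ⟨R_P, hAH1⟩ := hW
  have hRP : Tendsto R_P atTop (𝓝 0) := hAH1.2.2.1
  have hRPpos : ∀ T, 0 < R_P T := hAH1.1
  obtain ⟨A, M₀, hA⟩ := h3
  -- choose a large even `M`
  have hM1 : ∀ᶠ M : ℕ in atTop, |A| * (Real.sqrt (Real.log M) / M) ≤ ε / 4 := by
    have := (GLSS2026.tendsto_sqrt_log_div.const_mul |A|)
    rw [mul_zero] at this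
    exact (this.eventually (ge_mem_nhds (by positivity : (0:ℝ) < ε / 4))) |>.mono fun M hM ↦ hM
  obtain ⟨M₁, hM₁⟩ := (hM1.and (eventually_ge_atTop (max M₀ 1))).exists_forall_of_atTop
  set M : ℕ := 2 * M₁ with hMdef
  obtain ⟨hMa, hMc⟩ := hM₁ M (by omega)
  have hMM₀ : M₀ ≤ M := le_trans (le_max_left _ _) hMc
  have hM1' : 1 ≤ M := le_trans (le_max_right _ _) hMc
  have hMeven : Even M := ⟨M₁, by omega⟩
  have hMpos : (0 : ℝ) < M := by exact_mod_cast hM1'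
  have hM1r : (1 : ℝ) ≤ M := by exact_mod_cast hM1'
  obtain ⟨R, C, hRC⟩ := (GLSS2026.ahPairsAt_iff (M : ℝ)).mp (hAH M hMpos)
  have hR : Tendsto R atTop (𝓝 0) := hRC.2.2.1
  obtain ⟨A', hT3⟩ := hA M hMM₀ hMeven R C hRC R_P hAH1
  have herr : Tendsto (fun T : ℝ ↦ |A'| * M * (R T + R_P T + 1 / GLSS2026.L T ^ 2))
      atTop (𝓝 0) := by
    simpa using ((hR.add hRP).add GLSS2026.tendsto_inv_L_sq).const_mul (|A'| * M)
  have hsmall : ∀ᶠ T : ℝ in atTop, |A'| * M * (R T + R_P T + 1 / GLSS2026.L T ^ 2) < ε / 4 := by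
    filter_upwards [(Metric.tendsto_nhds.mp herr) (ε / 4) (by positivity)] with T hT
    rw [Real.dist_eq, sub_zero] at hT
    exact lt_of_abs_lt hT
  filter_upwards [hT3, hsmall, eventually_gt_atTop (1 : ℝ)] with T h3T hsT hT1
  obtain ⟨h3a, -⟩ := h3T
  have hP0 : AH.binDensity 0 T M (1 / 2) = GLSS2026.dens 0 T :=
    (GLSS2026.dens_eq_binDensity (by norm_num; linarith)).symm
  rw [hP0] at h3a
  set E : ℝ := R T + R_P T + 1 / GLSS2026.L T ^ 2 with hE
  have hE0 : 0 ≤ E := by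
    have := (hRC.1 T).le; have := (hRPpos T).le
    positivity
  have hsum : 0 ≤ (∑ j ∈ Finset.Icc 1 M, AH.binDensity (2 * (j : ℤ) - 1) T M (1 / 2)) / M :=
    div_nonneg (Finset.sum_nonneg fun j _ ↦ GLSS2026.binDensity_nonneg _ hT1 _ _) hMpos.le
  have h3' : |(3 / 2 - GLSS2026.dens 0 T) -
      (∑ j ∈ Finset.Icc 1 M, AH.binDensity (2 * (j : ℤ) - 1) T M (1 / 2)) / M| ≤
        |A| * (Real.sqrt (Real.log M) / M) + |A'| * M * E := by
    refine h3a.trans (add_le_add ?_ ?_)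
    · rw [mul_div_assoc]
      exact mul_le_mul_of_nonneg_right (le_abs_self A)
        (div_nonneg (Real.sqrt_nonneg _) hMpos.le)
    · exact mul_le_mul_of_nonneg_right (mul_le_mul_of_nonneg_right (le_abs_self A') hMpos.le) hE0
  have hb := (abs_le.mp h3').1
  linarith

/-! ## Part C: Aryan 2019, Theorem 1.1 -/

namespace Aryan2019

/-- The Farmer–Gonek–Lee normalisation used by Aryan 2019, §1: `γ̃ = (1/2π) γ log(γ/2π)` for the
`n`-th ordinate `γ = γ_n` (`zetaOrdinate n`). NOT Montgomery's `γ̃_n = γ_n log γ_n/(2π)` (tree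
`normalizedOrdinate`): the two differ by `γ_n log(2π)/(2π)`, and their consecutive differences by
`(γ_{n+1} − γ_n) log(2π)/(2π) → 0`; since Aryan's AH asks for EXACT half-integers the printed
normalisation is kept. [cite: Aryan2019, §1 (display before "The Alternative Hypothesis")] -/
def fglOrdinate (n : ℕ) : ℝ :=
  zetaOrdinate n / (2 * π) * Real.log (zetaOrdinate n / (2 * π))

/-- The `n`-th normalised neighbour spacing `γ̃⁺ − γ̃` in the FGL normalisation (`γ⁺` = the next
ordinate, with multiplicity). [cite: Aryan2019, §1 (AH display)] -/
def fglGap (n : ℕ) : ℝ :=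
  fglOrdinate (n + 1) - fglOrdinate n

/-- **Aryan 2019's Alternative Hypothesis (Farmer–Gonek–Lee form, threshold `T₀`)**: "There
exists a real number `T₀` such that if `γ > T₀`, then `γ̃⁺ − γ̃ ∈ ½ℤ`." As a predicate in `T₀`
(the printed hypothesis is `∃ T₀, AH T₀`); EXACT half-integers, no `o(1)` — a variant distinct
from the Lagarias–Rodgers, Baluyot and BGSTB forms of `AlternativeHypothesis.lean`, and not
identified with any of them. A PREDICATE, never asserted. [cite: Aryan2019, §1 (The Alternative Hypothesis (AH))] -/
def AH (T₀ : ℝ) : Prop :=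
  ∀ n : ℕ, T₀ < zetaOrdinate n → ∃ k : ℤ, fglGap n = k / 2

open scoped Classical in
/-- The proportion, among the first `N` neighbour spacings, of those equal to `σ`:
`#{n < N : γ̃_{n+1} − γ̃_n = σ}/N`. [cite: Aryan2019, §1 ("the proportion of normalized gaps … equal to σ")] -/
def gapProportionUpTo (σ : ℝ) (N : ℕ) : ℝ :=
  (((Finset.range N).filter fun n ↦ fglGap n = σ).card : ℝ) / N

/-- "`g_σ` is the proportion of normalized gaps between consecutive zeros that are equal to `σ`":
the counting ratio `gapProportionUpTo σ N` tends to `g` as `N → ∞`. The source presupposes that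
this proportion exists; we carry it as an explicit hypothesis. [cite: Aryan2019, §1 (definition of g_σ)] -/
def HasGapProportion (σ g : ℝ) : Prop :=
  Tendsto (gapProportionUpTo σ) atTop (𝓝 g)

/-- **Aryan 2019, Theorem 1.1** (PREPRINT, under review): "Assume the Riemann hypothesis and AH.
We have that `g_{1.5} ≥ 0.1079271`; `g_{1.5} ≥ 0.1 + 2(0.5 − g_1 + 0.0039635)`; for `k ≥ 2` we
have `g_k ≤ (0.18951 − 2(0.5 − g_1))/k`." Rendered with the hypotheses explicit: RH, Aryan's AH
beyond some `T₀`, and the (presupposed) existence of the proportions `g_σ` for `σ ∈ ½ℕ`, indexed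
as `g j` = the proportion of spacings equal to `j/2` (`g 2 = g_1`, `g 3 = g_{1.5}`; "`k ≥ 2`" =
half-integers `j/2`, `j ≥ 4`). The fourth printed item ("if `g_1 = 4/π²` then `g_2, g_{2.5}, … ≈ 0`")
is not a statement and is omitted. CLAIM of an unrefereed source; the deduction it prints is the
proved lemma `gapProportion_inequalities` below. [claim: Aryan2019, status: under-review] -/
def _root_.Literature.NumberTheory.LFunctions.aryan2019_theorem11 : Prop :=
  RiemannHypothesis → ∀ T₀ : ℝ, AH T₀ → ∀ g : ℕ → ℝ, (∀ j : ℕ, HasGapProportion (j / 2) (g j)) →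
    0.1079271 ≤ g 3 ∧
      0.1 + 2 * (0.5 - g 2 + 0.0039635) ≤ g 3 ∧
        ∀ j : ℕ, 4 ≤ j → g j ≤ (0.18951 - 2 * (0.5 - g 2)) / (j / 2)

/-- `6/π² ≥ 0.6079271` (from Mathlib's `Real.pi_lt_d20`; `6/π² = 0.60792710…`). [folklore] -/
private theorem six_mul_inv_pi_sq_ge : (0.6079271 : ℝ) ≤ 6 * (1 / π ^ 2) := by
  have hπ := Real.pi_lt_d20
  have h0 : 0 < π := Real.pi_pos
  have hπ2pos : 0 < π ^ 2 := by positivity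
  have h2 : π ^ 2 ≤ (3.14159265358979323847 : ℝ) ^ 2 := pow_le_pow_left₀ h0.le hπ.le 2
  rw [mul_one_div, le_div_iff₀ hπ2pos]
  calc (0.6079271 : ℝ) * π ^ 2 ≤ 0.6079271 * (3.14159265358979323847 : ℝ) ^ 2 := by gcongr
    _ ≤ 6 := by norm_num

/-- `8/π² ≥ 0.81049` (from `Real.pi_lt_d4`; `8/π² = 0.8105694…`). [folklore] -/
private theorem eight_mul_inv_pi_sq_ge : (0.81049 : ℝ) ≤ 8 * (1 / π ^ 2) := by
  have hπ := Real.pi_lt_d4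
  have h0 : 0 < π := Real.pi_pos
  have hπ2pos : 0 < π ^ 2 := by positivity
  have h2 : π ^ 2 ≤ (3.1416 : ℝ) ^ 2 := pow_le_pow_left₀ h0.le hπ.le 2
  rw [mul_one_div, le_div_iff₀ hπ2pos]
  calc (0.81049 : ℝ) * π ^ 2 ≤ 0.81049 * (3.1416 : ℝ) ^ 2 := by gcongr
    _ ≤ 8 := by norm_num

/-- **The deduction printed as the proof of Aryan 2019, Theorem 1.1 (§3), PROVED** — an RH-free,
AH-free statement about a sequence of non-negative reals `g j` (`j ≥ 1`, "the proportion of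
spacings equal to `j/2`") subject to the four inputs the source uses: (6.2) `Σ_{j≥1} g j = 1`,
(6.1) `Σ_{j≥1} (j/2) g j = 1` ("these gaps must cover the whole interval"), and Farmer–Gonek–Lee's
`g_{0.5} = 1/2 − 2/π²`, `g_1 ≤ 1/2` (the lower bound `4/π² ≤ g_1` is used in the source only for
its fourth, untyped item and is not needed here). Conclusions, with the closed forms the printed
decimals round: `g_{1.5} ≥ 6/π² − 1/2 ≥ 0.1079271`; `g_{1.5} ≥ 1/2 + 6/π² − 2 g_1 ≥
0.1 + 2(0.5 − g_1 + 0.0039635)`; and for `j ≥ 4`, `(j/2) g j ≤ 2 g_1 − 8/π² ≤ 2 g_1 − 0.81049 =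
0.18951 − 2(0.5 − g_1)`.
[cite: Aryan2019, §3 (proof of Theorem 1.1, (6.1)–(6.6))] -/
theorem gapProportion_inequalities (g : ℕ → ℝ) (hg : ∀ j, 0 ≤ g j)
    (h1 : HasSum (fun j : ℕ ↦ g (j + 1)) 1)
    (h2 : HasSum (fun j : ℕ ↦ ((j + 1 : ℕ) : ℝ) / 2 * g (j + 1)) 1)
    (h3 : g 1 = 1 / 2 - 2 / π ^ 2) (h5 : g 2 ≤ 1 / 2) :
    0.1079271 ≤ g 3 ∧
      0.1 + 2 * (0.5 - g 2 + 0.0039635) ≤ g 3 ∧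
        ∀ j : ℕ, 4 ≤ j → g j ≤ (0.18951 - 2 * (0.5 - g 2)) / (j / 2) := by
  -- numeric bounds on `1/π²` (the only place `π` enters)
  have hπ2pos : 0 < π ^ 2 := by positivity
  have hA : (0.6079271 : ℝ) ≤ 6 * (1 / π ^ 2) := six_mul_inv_pi_sq_ge
  have hB : (0.81049 : ℝ) ≤ 8 * (1 / π ^ 2) := eight_mul_inv_pi_sq_ge
  have h3' : g 1 = 1 / 2 - 2 * (1 / π ^ 2) := by rw [h3]; ring
  -- tails beyond the first three terms: `S = Σ_{j≥4} g j`, `W = Σ_{j≥4} (j/2) g j`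
  have hS : HasSum (fun j : ℕ ↦ g (j + 3 + 1)) (1 - ∑ i ∈ Finset.range 3, g (i + 1)) :=
    (hasSum_nat_add_iff' 3).mpr h1
  have hW : HasSum (fun j : ℕ ↦ ((j + 3 + 1 : ℕ) : ℝ) / 2 * g (j + 3 + 1))
      (1 - ∑ i ∈ Finset.range 3, ((i + 1 : ℕ) : ℝ) / 2 * g (i + 1)) :=
    (hasSum_nat_add_iff' 3).mpr h2
  have hsum3 : ∑ i ∈ Finset.range 3, g (i + 1) = g 1 + g 2 + g 3 := by
    simp only [Finset.sum_range_succ, Finset.sum_range_zero]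
    norm_num
  have hsum3' : ∑ i ∈ Finset.range 3, ((i + 1 : ℕ) : ℝ) / 2 * g (i + 1) =
      1 / 2 * g 1 + g 2 + 3 / 2 * g 3 := by
    simp only [Finset.sum_range_succ, Finset.sum_range_zero]
    norm_num
  rw [hsum3] at hS
  rw [hsum3'] at hW
  -- `2 S ≤ W` termwise (`j/2 ≥ 2` on the tail)
  have h2SW : 2 * (1 - (g 1 + g 2 + g 3)) ≤ 1 - (1 / 2 * g 1 + g 2 + 3 / 2 * g 3) := by
    refine hasSum_le (fun j ↦ ?_) (hS.mul_left 2) hW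
    have hj : (2 : ℝ) ≤ ((j + 3 + 1 : ℕ) : ℝ) / 2 := by
      have : (4 : ℝ) ≤ ((j + 3 + 1 : ℕ) : ℝ) := by exact_mod_cast (by omega : 4 ≤ j + 3 + 1)
      linarith
    exact mul_le_mul_of_nonneg_right hj (hg _)
  -- hence `g 3 ≥ 1/2 + 6/π² − 2 g 2 ≥ 6/π² − 1/2`
  have hkey : 1 / 2 + 6 * (1 / π ^ 2) - 2 * g 2 ≤ g 3 := by linarith
  refine ⟨by linarith, by linarith, fun j hj ↦ ?_⟩
  -- a single tail term is at most `W ≤ 2 g 2 − 8/π²`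
  have hjW : ((j : ℕ) : ℝ) / 2 * g j ≤ 1 - (1 / 2 * g 1 + g 2 + 3 / 2 * g 3) := by
    obtain ⟨i, rfl⟩ : ∃ i, j = i + 3 + 1 := ⟨j - 4, by omega⟩
    exact le_hasSum hW i fun k _ ↦ mul_nonneg (by positivity) (hg _)
  have hjpos : (0 : ℝ) < (j : ℝ) / 2 := by
    have : (4 : ℝ) ≤ (j : ℝ) := by exact_mod_cast hj
    linarith
  rw [le_div_iff₀ hjpos]
  have hW' : 1 - (1 / 2 * g 1 + g 2 + 3 / 2 * g 3) ≤ 2 * g 2 - 0.81049 := by linarith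
  linarith

/-- The proportions `g_σ`, when they exist, are non-negative (limits of counting ratios).
[cite: Aryan2019, §1 (definition of g_σ)] -/
theorem HasGapProportion.nonneg {σ g : ℝ} (h : HasGapProportion σ g) : 0 ≤ g :=
  ge_of_tendsto' h fun _ ↦ div_nonneg (Nat.cast_nonneg _) (Nat.cast_nonneg _)

/-- **Theorem 1.1 modulo its four printed inputs.** If, under RH and Aryan's AH, the gap
proportions satisfy the inputs the printed proof invokes — (6.2) `Σ_σ g_σ = 1`, (6.1)
`Σ_σ σ·g_σ = 1`, and Farmer–Gonek–Lee's `g_{0.5} = 1/2 − 2/π²`, `g_1 ≤ 1/2` — then the claim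
`aryan2019_theorem11` holds, by the proved deduction `gapProportion_inequalities`. The inputs are
carried as the hypothesis `hin` (they are results of Farmer–Gonek–Lee 2014 and the covering
identity of §3, not typed in this file). [cite: Aryan2019, §3 (proof of Theorem 1.1)] -/
theorem _root_.Literature.NumberTheory.LFunctions.aryan2019_theorem11_of_inputs
    (hin : RiemannHypothesis → ∀ T₀ : ℝ, AH T₀ → ∀ g : ℕ → ℝ,
      (∀ j : ℕ, HasGapProportion (j / 2) (g j)) →
        HasSum (fun j : ℕ ↦ g (j + 1)) 1 ∧
          HasSum (fun j : ℕ ↦ ((j + 1 : ℕ) : ℝ) / 2 * g (j + 1)) 1 ∧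
            g 1 = 1 / 2 - 2 / π ^ 2 ∧ g 2 ≤ 1 / 2) :
    aryan2019_theorem11 := by
  intro hRH T₀ hAH g hg
  obtain ⟨h1, h2, h3, h5⟩ := hin hRH T₀ hAH g hg
  exact gapProportion_inequalities g (fun j ↦ (hg j).nonneg) h1 h2 h3 h5

end Aryan2019

/-! ## Part D: GLSS 2026's ESH `(ES1) ∧ (ES2)` **is** the tree's `EssentialSimplicityHypothesis`
(identification, PROVED unconditionally)

GLSS 2026 take "(ES1) and (ES2)" as the precise meaning of the Essential Simplicity Hypothesis
("from [GLSS1]"); the tree (`AlternativeHypothesis.lean`) types ESH in the Mueller 1983 / Ivić 2002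
pair-count form `EssentialSimplicityHypothesis`: for every `ε > 0` some `α > 0` has
`#{0 < γ, γ' ≤ T : |γ − γ'| ≤ 2πα/log T} ≤ (1 + ε) N(T)` for all large `T`. The two typed
hypotheses are EQUIVALENT statements about the ordinates (`esh_iff_essentialSimplicityHypothesis`),
by elementary counting plus `N(T) ∼ T L` (Riemann–von Mangoldt, tree theorem
`RudnickSarnak.tendsto_zetaZeroCount_div_main`): the symmetric window count splits as
`N⊛(T) + 2 N(T, α)` (swap the pair; `pairCorrelationCount_neg_eq`), `N⊛(T) ≥ N(T)` (the diagonal),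
and "(ES2) for every function `λ₀ → 0`" is equivalent to "for every `c > 0` some FIXED `α > 0` has
`N(T, α) ≤ c T L` for all large `T`" (a diagonal-sequence argument, `ES2.exists_eventually_le`).
Consequently the direction "`p_0 = 1 ⇒ ESH`" of GLSS 2026 Theorem 1 holds WITHOUT AH-Pairs
(`GLSS2026.esh_of_hasLimitingDensity_one`, from the tree theorem
`essentialSimplicity_of_hasLimitingDensity_one` of `AlternativeHypothesisESHProofs.lean`). -/

namespace GLSS2026

/-- `T · L(T) = (T/2π) log T`. [cite: GoldstonLeeSchettlerSuriajaya2026, §1 eq. (1.1)] -/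
theorem mul_L (T : ℝ) : T * L T = T / (2 * π) * Real.log T := by
  unfold L
  ring

/-- `L(T) > 0` for `T > 1`. [cite: GoldstonLeeSchettlerSuriajaya2026, §1 eq. (1.1)] -/
theorem L_pos {T : ℝ} (hT : 1 < T) : 0 < L T := by
  unfold L
  exact div_pos (Real.log_pos hT) (by positivity)

/-- `N(T)/(T L) → 1` (Riemann–von Mangoldt in ratio form; the tree theorem
`RudnickSarnak.tendsto_zetaZeroCount_div_main`, restated with `T L = (T/2π) log T`).
[cite: Titchmarsh1986, Thm. 9.4] -/
theorem tendsto_zetaZeroCount_div_mul_L :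
    Tendsto (fun T : ℝ ↦ (zetaZeroCount T : ℝ) / (T * L T)) atTop (𝓝 1) := by
  simp only [mul_L]
  exact RudnickSarnak.tendsto_zetaZeroCount_div_main

/-- The diagonal (equal indices) lies among the coincident pairs: `N(T) ≤ N⊛(T)` ("`N⊛(T) ≥ N(T)`",
used by GLSS 2026 in the proof of Corollary 1). [cite: GoldstonLeeSchettlerSuriajaya2026, §1 (definition of N⊛)] -/
theorem zetaZeroCount_le_coincidentPairCount (T : ℝ) :
    zetaZeroCount T ≤ coincidentPairCount T := by
  classical
  unfold coincidentPairCount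
  calc zetaZeroCount T
      = ((zeroIndexSet T).map ⟨fun n : ℕ ↦ (n, n), fun a b h ↦ by simpa using h⟩).card := by
        rw [Finset.card_map, card_zeroIndexSet]
    _ ≤ _ := Finset.card_le_card fun p hp ↦ by
        obtain ⟨n, hn, rfl⟩ := Finset.mem_map.mp hp
        simpa using hn

/-- `N(T, λ)` is non-decreasing in `λ`. [cite: GoldstonLeeSchettlerSuriajaya2026, §1 eq. (1.2)] -/
theorem pairCount_mono (T : ℝ) {l₁ l₂ : ℝ} (h : l₁ ≤ l₂) : pairCount T l₁ ≤ pairCount T l₂ := by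
  classical
  unfold pairCount
  exact Finset.card_le_card fun p hp ↦ by
    rw [Finset.mem_filter] at hp ⊢
    exact ⟨hp.1, hp.2.1, hp.2.2.trans h⟩

open scoped Classical in
/-- Counting: a symmetric window `[-a, a]` (`a ≥ 0`) of a real statistic `d` on a finite set that
is invariant under an involution-like symmetry `e` with `d ∘ e = −d` splits as the zero set plus
twice the one-sided window `(0, a]`. [folklore] -/
private theorem card_filter_abs_window {ι : Type*} (s : Finset ι) (d : ι → ℝ) {a : ℝ}
    (ha : 0 ≤ a) (e : ι ≃ ι) (hs : ∀ i, e i ∈ s ↔ i ∈ s) (hd : ∀ i, d (e i) = -d i) :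
    (s.filter fun i ↦ -a ≤ d i ∧ d i ≤ a).card =
      (s.filter fun i ↦ d i = 0).card + 2 * (s.filter fun i ↦ 0 < d i ∧ d i ≤ a).card := by
  set A := s.filter fun i ↦ d i = 0 with hA
  set B := s.filter fun i ↦ 0 < d i ∧ d i ≤ a with hB
  set C := s.filter fun i ↦ -a ≤ d i ∧ d i < 0 with hC
  have hCB : C.card = B.card := by
    rw [hC, hB, ← Finset.card_map e.toEmbedding]
    congr 1
    ext i
    simp only [Finset.mem_map_equiv, Finset.mem_filter]
    have hs' : e.symm i ∈ s ↔ i ∈ s := by simpa using (hs (e.symm i)).symm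
    have hd' : d (e.symm i) = -d i := by
      have := hd (e.symm i)
      simp only [Equiv.apply_symm_apply] at this
      linarith
    rw [hs', hd']
    constructor
    · rintro ⟨h0, h1, h2⟩
      exact ⟨h0, by linarith, by linarith⟩
    · rintro ⟨h0, h1, h2⟩
      exact ⟨h0, by linarith, by linarith⟩
  have hAB : Disjoint A B :=
    Finset.disjoint_filter.mpr fun i _ h1 h2 ↦ by rw [h1] at h2; exact lt_irrefl _ h2.1
  have hABC : Disjoint (A ∪ B) C := by
    refine Finset.disjoint_union_left.mpr ⟨?_, ?_⟩
    · exact Finset.disjoint_filter.mpr fun i _ h1 h2 ↦ by rw [h1] at h2; exact lt_irrefl _ h2.2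
    · exact Finset.disjoint_filter.mpr fun i _ h1 h2 ↦ by linarith [h1.1, h2.2]
  have hunion : (s.filter fun i ↦ -a ≤ d i ∧ d i ≤ a) = A ∪ B ∪ C := by
    ext i
    simp only [hA, hB, hC, Finset.mem_union, Finset.mem_filter]
    constructor
    · rintro ⟨hi, h1, h2⟩
      rcases lt_trichotomy (d i) 0 with h | h | h
      · exact Or.inr ⟨hi, h1, h⟩
      · exact Or.inl (Or.inl ⟨hi, h⟩)
      · exact Or.inl (Or.inr ⟨hi, h, h2⟩)
    · rintro ((⟨hi, h⟩ | ⟨hi, h1, h2⟩) | ⟨hi, h1, h2⟩)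
      · exact ⟨hi, by rw [h]; linarith, by rw [h]; exact ha⟩
      · exact ⟨hi, by linarith, h2⟩
      · exact ⟨hi, h1, by linarith⟩
  rw [hunion, Finset.card_union_of_disjoint hABC, Finset.card_union_of_disjoint hAB, hCB]
  ring

/-- **Splitting the symmetric window.** For `T > 1` and `α ≥ 0`, the pair-correlation count on
`[−α, α]` (pairs with multiplicity, diagonal included) is the coincident pairs plus twice GLSS's
one-sided count: `#{0 < γ, γ' ≤ T : |γ − γ'| ≤ 2πα/log T} = N⊛(T) + 2 N(T, α)` (swap `(γ, γ')`;
`λ/L = 2πλ/log T`). [cite: GoldstonLeeSchettlerSuriajaya2026, §1 eq. (1.2) and the display before (ES1)] -/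
theorem pairCorrelationCount_neg_eq (T α : ℝ) (hT : 1 < T) (hα : 0 ≤ α) :
    pairCorrelationCount (-α) α T = coincidentPairCount T + 2 * pairCount T α := by
  classical
  have hL : 0 < L T := L_pos hT
  have hlog : 0 < Real.log T := Real.log_pos hT
  have ha : 0 ≤ 2 * π * α / Real.log T := div_nonneg (by positivity) hlog.le
  have hconv : 2 * π * α / Real.log T = α / L T := by
    unfold L
    field_simp
  have h1 : pairCorrelationCount (-α) α T =
      ((zeroIndexSet T ×ˢ zeroIndexSet T).filter fun p ↦
        -(2 * π * α / Real.log T) ≤ zetaOrdinate p.1 - zetaOrdinate p.2 ∧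
          zetaOrdinate p.1 - zetaOrdinate p.2 ≤ 2 * π * α / Real.log T).card := by
    unfold pairCorrelationCount
    congr 1
    refine Finset.filter_congr fun p _ ↦ ?_
    rw [show 2 * π * -α / Real.log T = -(2 * π * α / Real.log T) by ring]
  have h2 : coincidentPairCount T =
      ((zeroIndexSet T ×ˢ zeroIndexSet T).filter fun p ↦
        zetaOrdinate p.1 - zetaOrdinate p.2 = 0).card := by
    unfold coincidentPairCount
    congr 1
    exact Finset.filter_congr fun p _ ↦ sub_eq_zero.symm
  have h3 : pairCount T α =
      ((zeroIndexSet T ×ˢ zeroIndexSet T).filter fun p ↦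
        0 < zetaOrdinate p.1 - zetaOrdinate p.2 ∧
          zetaOrdinate p.1 - zetaOrdinate p.2 ≤ 2 * π * α / Real.log T).card := by
    unfold pairCount
    congr 1
    refine Finset.filter_congr fun p _ ↦ ?_
    rw [mul_pos_iff_of_pos_right hL, hconv, le_div_iff₀ hL]
  rw [h1, h2, h3]
  exact card_filter_abs_window _ (fun p : ℕ × ℕ ↦ zetaOrdinate p.1 - zetaOrdinate p.2) ha
    (Equiv.prodComm ℕ ℕ) (fun p ↦ by simp [Finset.mem_product, and_comm]) (fun p ↦ by simp)

/-- **(ES2), uniform form.** GLSS's (ES2) — "`N(T, λ₀) = o(TL)` if `λ₀ → 0`", for every function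
`λ₀` — implies (and, by monotonicity of `N(T, ·)`, is equivalent to): for every `c > 0` there is a
FIXED `α > 0` with `N(T, α) ≤ c T L` for all large `T`. (Diagonal argument: otherwise pick
`T_k → ∞` with `N(T_k, 1/(k+1)) > c T_k L` and let `λ₀ = 1/(k+1)` at `T_k`, `0` elsewhere.)
[cite: GoldstonLeeSchettlerSuriajaya2026, §1 (ES2)] -/
theorem ES2.exists_eventually_le (h : ES2) {c : ℝ} (hc : 0 < c) :
    ∃ α : ℝ, 0 < α ∧ ∀ᶠ T : ℝ in atTop, (pairCount T α : ℝ) / (T * L T) ≤ c := by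
  classical
  by_contra hcon
  push Not at hcon
  have hfreq : ∀ (k : ℕ) (M : ℝ), ∃ T, M ≤ T ∧
      c < (pairCount T (1 / ((k : ℝ) + 1)) : ℝ) / (T * L T) := by
    intro k M
    have hk := hcon (1 / ((k : ℝ) + 1)) (by positivity)
    obtain ⟨T, hTM, hT⟩ := Filter.frequently_atTop.mp hk M
    exact ⟨T, hTM, hT⟩
  choose f hf using hfreq
  -- the diagonal sequence `T_k`
  obtain ⟨Tseq, hT0, hTs⟩ : ∃ Tseq : ℕ → ℝ,
      Tseq 0 = f 0 0 ∧ ∀ k, Tseq (k + 1) = f (k + 1) (Tseq k + 1) :=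
    ⟨fun k ↦ Nat.rec (f 0 0) (fun k t ↦ f (k + 1) (t + 1)) k, rfl, fun k ↦ rfl⟩
  have hstep : ∀ k, Tseq k + 1 ≤ Tseq (k + 1) := fun k ↦ by
    rw [hTs]
    exact (hf _ _).1
  have hmono : StrictMono Tseq := strictMono_nat_of_lt_succ fun k ↦ by linarith [hstep k]
  have hgood : ∀ k, c < (pairCount (Tseq k) (1 / ((k : ℝ) + 1)) : ℝ) / (Tseq k * L (Tseq k)) := by
    intro k
    cases k with
    | zero => rw [hT0]; exact (hf 0 0).2
    | succ k => rw [hTs]; exact (hf (k + 1) _).2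
  have hge : ∀ k : ℕ, (k : ℝ) ≤ Tseq k := by
    intro k
    induction k with
    | zero => rw [Nat.cast_zero, hT0]; exact (hf 0 0).1
    | succ k ih => push_cast; linarith [hstep k]
  have hTend : Tendsto Tseq atTop atTop := tendsto_atTop_mono hge tendsto_natCast_atTop_atTop
  -- `λ₀`: `1/(k+1)` at `T_k`, `0` elsewhere
  obtain ⟨lam₀, hlamT, hlam_else⟩ : ∃ lam₀ : ℝ → ℝ,
      (∀ k, lam₀ (Tseq k) = 1 / ((k : ℝ) + 1)) ∧ ∀ T, (¬∃ k, Tseq k = T) → lam₀ T = 0 :=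
    ⟨Function.extend Tseq (fun k ↦ 1 / ((k : ℝ) + 1)) 0,
      fun k ↦ hmono.injective.extend_apply _ _ k,
      fun T hT ↦ by rw [Function.extend_apply' _ _ _ hT]; rfl⟩
  have hlam : Tendsto lam₀ atTop (𝓝 0) := by
    rw [Metric.tendsto_atTop]
    intro ε hε
    obtain ⟨K, hK⟩ := exists_nat_one_div_lt hε
    refine ⟨Tseq K + 1, fun T hT ↦ ?_⟩
    rw [Real.dist_0_eq_abs]
    by_cases hex : ∃ k, Tseq k = T
    · obtain ⟨k, rfl⟩ := hex
      have hKk : K < k := hmono.lt_iff_lt.mp (by linarith)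
      rw [hlamT, abs_of_pos (by positivity)]
      calc 1 / ((k : ℝ) + 1) ≤ 1 / ((K : ℝ) + 1) := by
            gcongr
        _ < ε := hK
    · rw [hlam_else T hex, abs_zero]
      exact hε
  -- apply (ES2) along `T_k`
  obtain ⟨k, hk⟩ := (((h lam₀ hlam).comp hTend).eventually (gt_mem_nhds hc)).exists
  rw [Function.comp_apply, hlamT] at hk
  exact absurd (hgood k) (not_lt.mpr hk.le)

/-- Squeeze at `1`: if `u → 1`, `u ≤ g` eventually, and for every `ε > 0` eventually
`g ≤ (1 + ε) u`, then `g → 1`. [folklore] -/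
private theorem tendsto_one_of_le_of_le_mul {u g : ℝ → ℝ} (hu : Tendsto u atTop (𝓝 1))
    (h1 : ∀ᶠ T in atTop, u T ≤ g T)
    (h2 : ∀ ε : ℝ, 0 < ε → ∀ᶠ T in atTop, g T ≤ (1 + ε) * u T) :
    Tendsto g atTop (𝓝 1) := by
  rw [tendsto_order]
  refine ⟨fun a ha ↦ ?_, fun b hb ↦ ?_⟩
  · filter_upwards [h1, hu.eventually (lt_mem_nhds ha)] with T h1 h2 using lt_of_lt_of_le h2 h1
  · have hε : 0 < (b - 1) / 2 := by linarith
    have hpos : 0 < 1 + (b - 1) / 2 := by linarith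
    have hb' : 1 < b / (1 + (b - 1) / 2) := by
      rw [lt_div_iff₀ hpos]
      linarith
    filter_upwards [h2 _ hε, hu.eventually (gt_mem_nhds hb')] with T h2 h3
    calc g T ≤ (1 + (b - 1) / 2) * u T := h2
      _ < (1 + (b - 1) / 2) * (b / (1 + (b - 1) / 2)) := mul_lt_mul_of_pos_left h3 hpos
      _ = b := by field_simp

/-- Squeeze at `0` from above: an eventually non-negative function that is eventually `≤ c` for
every `c > 0` tends to `0`. [folklore] -/
private theorem tendsto_zero_of_nonneg_of_eventually_le {f : ℝ → ℝ}
    (h0 : ∀ᶠ T in atTop, 0 ≤ f T) (h : ∀ c : ℝ, 0 < c → ∀ᶠ T in atTop, f T ≤ c) :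
    Tendsto f atTop (𝓝 0) := by
  rw [tendsto_order]
  refine ⟨fun a ha ↦ h0.mono fun T hT ↦ ha.trans_le hT, fun b hb ↦ ?_⟩
  filter_upwards [h (b / 2) (by positivity)] with T hT
  linarith

/-- Converse of `ES2.exists_eventually_le`: the fixed-`α` form implies (ES2), by monotonicity of
`N(T, ·)` (`N(T, λ₀(T)) ≤ N(T, α)` once `λ₀(T) ≤ α`). [cite: GoldstonLeeSchettlerSuriajaya2026, §1 (ES2)] -/
theorem ES2.of_forall_exists_eventually_le
    (h : ∀ c : ℝ, 0 < c → ∃ α : ℝ, 0 < α ∧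
      ∀ᶠ T : ℝ in atTop, (pairCount T α : ℝ) / (T * L T) ≤ c) : ES2 := by
  intro lam₀ hlam
  have hT1 : ∀ᶠ T : ℝ in atTop, 1 < T := eventually_gt_atTop 1
  refine tendsto_zero_of_nonneg_of_eventually_le ?_ fun c hc ↦ ?_
  · filter_upwards [hT1] with T hT
    exact div_nonneg (Nat.cast_nonneg _) (mul_pos (by linarith) (L_pos hT)).le
  · obtain ⟨α, hα, hev⟩ := h c hc
    filter_upwards [hev, hT1, hlam.eventually (gt_mem_nhds hα)] with T hT hT1 hlamT
    have hTL : 0 < T * L T := mul_pos (by linarith) (L_pos hT1)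
    have hmono : (pairCount T (lam₀ T) : ℝ) ≤ pairCount T α := by
      exact_mod_cast pairCount_mono T hlamT.le
    exact (div_le_div_of_nonneg_right hmono hTL.le).trans hT

/-- **(ES2) ⇔ its fixed-`α` form**: "`N(T, λ₀) = o(TL)` whenever `λ₀ → 0`" iff "for every `c > 0`
some `α > 0` has `N(T, α) ≤ c·TL` for all large `T`". [cite: GoldstonLeeSchettlerSuriajaya2026, §1 (ES2)] -/
theorem ES2_iff_forall_exists_eventually_le :
    ES2 ↔ ∀ c : ℝ, 0 < c → ∃ α : ℝ, 0 < α ∧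
      ∀ᶠ T : ℝ in atTop, (pairCount T α : ℝ) / (T * L T) ≤ c :=
  ⟨fun h _ hc ↦ h.exists_eventually_le hc, ES2.of_forall_exists_eventually_le⟩

/-- **The tree's ESH implies GLSS 2026's ESH `(ES1) ∧ (ES2)`.** From
`N⊛(T) + 2N(T, α) ≤ (1 + ε) N(T)` (all large `T`) and `N(T) ≤ N⊛(T)`, `N(T) ∼ TL`:
`N⊛(T)/(TL) → 1` and `N(T, λ₀(T)) ≤ N(T, α) ≤ (ε/2) N(T)` once `λ₀(T) ≤ α`.
[cite: GoldstonLeeSchettlerSuriajaya2026, §1 (ES1), (ES2)] -/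
theorem esh_of_essentialSimplicityHypothesis (h : EssentialSimplicityHypothesis) : ESH := by
  have hN := tendsto_zetaZeroCount_div_mul_L
  have hT1 : ∀ᶠ T : ℝ in atTop, 1 < T := eventually_gt_atTop 1
  have key : ∀ ε : ℝ, 0 < ε → ∃ α : ℝ, 0 < α ∧ ∀ᶠ T : ℝ in atTop,
      (coincidentPairCount T : ℝ) + 2 * pairCount T α ≤ (1 + ε) * zetaZeroCount T := by
    intro ε hε
    obtain ⟨α, hα, hev⟩ := h ε hε
    refine ⟨α, hα, ?_⟩
    filter_upwards [hev, hT1] with T hT hT1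
    rw [pairCorrelationCount_neg_eq T α hT1 hα.le] at hT
    exact_mod_cast hT
  have hdiag : ∀ T : ℝ, (zetaZeroCount T : ℝ) ≤ coincidentPairCount T := fun T ↦ by
    exact_mod_cast zetaZeroCount_le_coincidentPairCount T
  constructor
  · refine tendsto_one_of_le_of_le_mul hN ?_ ?_
    · filter_upwards [hT1] with T hT
      have hTL : 0 < T * L T := mul_pos (by linarith) (L_pos hT)
      exact div_le_div_of_nonneg_right (hdiag T) hTL.le
    · intro ε hε
      obtain ⟨α, -, hev⟩ := key ε hε
      filter_upwards [hev, hT1] with T hT hT1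
      have hTL : 0 < T * L T := mul_pos (by linarith) (L_pos hT1)
      have hP : (0 : ℝ) ≤ pairCount T α := Nat.cast_nonneg _
      rw [← mul_div_assoc]
      exact div_le_div_of_nonneg_right (by linarith) hTL.le
  · intro lam₀ hlam
    refine tendsto_zero_of_nonneg_of_eventually_le ?_ ?_
    · filter_upwards [hT1] with T hT
      exact div_nonneg (Nat.cast_nonneg _) (mul_pos (by linarith) (L_pos hT)).le
    · intro c hc
      obtain ⟨α, hα, hev⟩ := key c hc
      filter_upwards [hev, hT1, hlam.eventually (gt_mem_nhds hα),
        hN.eventually (gt_mem_nhds one_lt_two)] with T hT hT1 hlamT hNT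
      have hTL : 0 < T * L T := mul_pos (by linarith) (L_pos hT1)
      have hmono : (pairCount T (lam₀ T) : ℝ) ≤ pairCount T α := by
        exact_mod_cast pairCount_mono T hlamT.le
      rw [div_le_iff₀ hTL]
      rw [div_lt_iff₀ hTL] at hNT
      have h2 : 2 * (pairCount T α : ℝ) ≤ c * zetaZeroCount T := by linarith [hdiag T]
      have h3 : c * (zetaZeroCount T : ℝ) ≤ c * (2 * (T * L T)) :=
        mul_le_mul_of_nonneg_left hNT.le hc.le
      linarith

/-- **GLSS 2026's ESH `(ES1) ∧ (ES2)` implies the tree's ESH.** Given `ε > 0`: a fixed `α > 0`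
with `N(T, α) ≤ (ε/8) TL` (uniform (ES2)), `N⊛(T) < (1 + ε/4) TL` ((ES1)) and
`TL (1 + ε/2)/(1 + ε) < N(T)` (`N ∼ TL`) give `N⊛(T) + 2N(T, α) ≤ (1 + ε) N(T)`.
[cite: Ivic2002SmallValues, (32)–(33)] -/
theorem essentialSimplicityHypothesis_of_esh (h : ESH) : EssentialSimplicityHypothesis := by
  intro ε hε
  have hN := tendsto_zetaZeroCount_div_mul_L
  have hT1 : ∀ᶠ T : ℝ in atTop, 1 < T := eventually_gt_atTop 1
  obtain ⟨α, hα, hP⟩ := h.2.exists_eventually_le (c := ε / 8) (by positivity)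
  refine ⟨α, hα, ?_⟩
  have hr : (1 + ε / 2) / (1 + ε) < 1 := by
    rw [div_lt_one (by positivity)]
    linarith
  have hε4 : (1 : ℝ) < 1 + ε / 4 := by linarith
  filter_upwards [hP, hT1, h.1.eventually (gt_mem_nhds hε4), hN.eventually (lt_mem_nhds hr)]
    with T hP hT1 hC hNT
  have hTL : 0 < T * L T := mul_pos (by linarith) (L_pos hT1)
  rw [pairCorrelationCount_neg_eq T α hT1 hα.le]
  push_cast
  rw [div_le_iff₀ hTL] at hP
  rw [div_lt_iff₀ hTL] at hC
  rw [lt_div_iff₀ hTL] at hNT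
  have hne : (1 + ε : ℝ) ≠ 0 := by positivity
  have key : (1 + ε / 2) * (T * L T) < (1 + ε) * zetaZeroCount T := by
    have e : (1 + ε / 2) * (T * L T) = (1 + ε) * ((1 + ε / 2) / (1 + ε) * (T * L T)) := by
      field_simp
    rw [e]
    exact mul_lt_mul_of_pos_left hNT (by positivity)
  linarith

/-- **GLSS 2026's ESH is the tree's ESH**: `(ES1) ∧ (ES2) ↔ EssentialSimplicityHypothesis`
(Mueller 1983 / Ivić 2002 pair-count form), unconditionally. This identifies the hypothesis of
GLSS 2026, Theorem 1 / Corollary 1 with the conclusion "and thus ESH" of BGSTB 2025, Theorem 2 as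
typed in the tree. [cite: GoldstonLeeSchettlerSuriajaya2026, §1 (ESH = (ES1) ∧ (ES2))] -/
theorem esh_iff_essentialSimplicityHypothesis : ESH ↔ EssentialSimplicityHypothesis :=
  ⟨essentialSimplicityHypothesis_of_esh, esh_of_essentialSimplicityHypothesis⟩

/-- **Half of GLSS 2026 Theorem 1 holds without AH-Pairs**: if the diagonal limiting density is
`p_0 = 1` for some bin half-width `δ > 0` (`AH.HasLimitingDensity 0 δ 1`), then (ES1) ∧ (ES2) —
by the tree theorem `essentialSimplicity_of_hasLimitingDensity_one` (unconditional) and the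
identification `esh_iff_essentialSimplicityHypothesis`. (The converse direction of Theorem 1 is
where GLSS use RH-free pair correlation AND AH-Pairs; it stays part of the named fact
`glss2026_theorem1`.) [cite: GoldstonLeeSchettlerSuriajaya2026, §1 Theorem 1 (direction p₀ = 1 ⇒ ESH)] -/
theorem esh_of_hasLimitingDensity_one {δ : ℝ} (hδ : 0 < δ) (h : AH.HasLimitingDensity 0 δ 1) :
    ESH :=
  esh_of_essentialSimplicityHypothesis (essentialSimplicity_of_hasLimitingDensity_one hδ h)

end GLSS2026

/-- The `→` direction of `glss2026_theorem1` needs neither RH nor AH-Pairs: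
`p_0 = 1` (bins of half-width `1/2`) implies GLSS's ESH. [cite: GoldstonLeeSchettlerSuriajaya2026, §1 Theorem 1] -/
theorem glss2026_theorem1_mp_unconditional (h : AH.HasLimitingDensity 0 (1 / 2) 1) :
    GLSS2026.ESH :=
  GLSS2026.esh_of_hasLimitingDensity_one one_half_pos h

/-- BGSTB 2025, Theorem 2 "and thus ESH", in GLSS's precise form: `bgstb2025_theorem2` (claim),
RH and Strong AH-Pairs give (ES1) ∧ (ES2) (tree theorem `essentialSimplicity_of_theorem2` +
identification). [cite: BaluyotGoldstonSuriajayaTurnageButterbaugh2025, Theorem 2] -/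
theorem GLSS2026.esh_of_bgstb2025_theorem2 (h : bgstb2025_theorem2) (hRH : RiemannHypothesis)
    (hS : StrongAHPairs) : GLSS2026.ESH :=
  GLSS2026.esh_of_essentialSimplicityHypothesis (essentialSimplicity_of_theorem2 h hRH hS)

/-! ## Part E: (ES1) alone gives 100% simple zeros on the critical line — GLSS 2026 Corollary 1
DISCHARGED (and with no AH-Pairs); Theorem 4 from Theorem 3 (appended 2026-08-26)

Write `c(v) = #{n < N(T) : γ_n = v}` for the multiplicity of a height `v` in the enumeration. The
tree's ordinate dictionary (`Montgomery.card_filter_zetaOrdinate_eq`,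
`Montgomery.finsum_zetaZeroBox_mul_eq_sum_range`, `ZetaZeroBoxEnumeration.lean`; Titchmarsh §9.1)
gives `c(v) = Σ_{ρ in the box, Im ρ = v} m(ρ)`, `N⊛(T) = Σ_{i<N(T)} c(γ_i) = Σ_ρ m(ρ) c(Im ρ)` and
`N(T) = Σ_ρ m(ρ)` (sums over the distinct zeros `ρ` of the box `0 < Im ρ ≤ T`). Always
`c(Im ρ) ≥ m(ρ)`; if `ρ` is OFF the critical line, its reflection `1 − ρ̄ ≠ ρ` is a zero of the
same height and the same multiplicity (`riemannZetaZeroOrder_one_sub_conj`, Titchmarsh §2.12), so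
`c(Im ρ) ≥ 2m(ρ)`. Hence `m(ρ)c(Im ρ) ≥ 2m(ρ) − [ρ simple and on the line]` zero by zero, i.e.
**`N⁽¹⁾(T) ≥ 2N(T) − N⊛(T)` for every `T`**
(`GLSS2026.two_mul_zetaZeroCount_sub_coincidentPairCount_le`, unconditional; the counting is that
of Montgomery 1973, §3, where under RH `Σ m(ρ)² ≤ (4/3 + o(1))N` yields "at least `2/3` of the zeros
are simple"). With (ES1), `N⊛ ∼ TL ∼ N`, so `N⁽¹⁾(T)/N(T) → 1`
(`GLSS2026.almostAllSimpleOnLine_of_ES1`): GLSS 2026 Corollary 1 holds, with NO AH-Pairs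
(`glss2026_corollary1_holds`, via Part D), and Theorem 4 follows from Theorem 3 alone
(`glss2026_theorem4_of_theorem3`). -/

namespace GLSS2026

/-- `N⁽¹⁾(T)` as a `Finset` count over the box of zeros `0 < Im ρ ≤ T` (a zero on the line lies in
both boxes `zetaZeroBox (1/2) T ⊆ zetaZeroBox 0 T`). [folklore] -/
private theorem simpleCriticalZeroCount_eq_card_filter (T : ℝ) :
    simpleCriticalZeroCount T =
      ((zetaZeroBox_finite 0 T).toFinset.filter
        fun ρ ↦ ρ.re = 1 / 2 ∧ riemannZetaZeroOrder ρ = 1).card := by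
  classical
  have hset : {ρ ∈ zetaZeroBox (1 / 2) T | ρ.re = 1 / 2 ∧ riemannZetaZeroOrder ρ = 1} =
      ↑((zetaZeroBox_finite 0 T).toFinset.filter
        fun ρ ↦ ρ.re = 1 / 2 ∧ riemannZetaZeroOrder ρ = 1) := by
    ext ρ
    simp only [Set.mem_setOf_eq, Finset.coe_filter, Set.Finite.mem_toFinset]
    constructor
    · rintro ⟨⟨h0, h1, h2, h3, h4⟩, h5, h6⟩
      exact ⟨⟨h0, by rw [h5]; norm_num, h2, h3, h4⟩, h5, h6⟩
    · rintro ⟨⟨h0, h1, h2, h3, h4⟩, h5, h6⟩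
      exact ⟨⟨h0, by rw [h5], h2, h3, h4⟩, h5, h6⟩
  unfold simpleCriticalZeroCount
  rw [hset, Set.ncard_coe_finset]

/-- `N⁽¹⁾(T) ≤ N(T)`: the simple zeros on the line are among the zeros of the box, each of
multiplicity `≥ 1` in `N(T) = Σ_ρ m(ρ)` (`zetaZeroCount_eq_finsum`). [cite: Titchmarsh1986, §9.1, §10.1] -/
theorem simpleCriticalZeroCount_le_zetaZeroCount (T : ℝ) :
    simpleCriticalZeroCount T ≤ zetaZeroCount T := by
  classical
  have hpos : ∀ ρ ∈ (zetaZeroBox_finite 0 T).toFinset, 0 < riemannZetaZeroOrder ρ := fun ρ hρ ↦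
    DiophantineGeometry.riemannZetaZeroOrder_pos_of_mem_zetaZeroBox ((Set.Finite.mem_toFinset _).1 hρ)
  have h : (simpleCriticalZeroCount T : ℤ) ≤ zetaZeroCount T := by
    rw [simpleCriticalZeroCount_eq_card_filter, zetaZeroCount_eq_finsum,
      finsum_mem_eq_finite_toFinset_sum _ (zetaZeroBox_finite 0 T)]
    calc (((zetaZeroBox_finite 0 T).toFinset.filter
            fun ρ ↦ ρ.re = 1 / 2 ∧ riemannZetaZeroOrder ρ = 1).card : ℤ)
        ≤ ((zetaZeroBox_finite 0 T).toFinset.card : ℤ) := by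
          exact_mod_cast Finset.card_filter_le _ _
      _ = ∑ ρ ∈ (zetaZeroBox_finite 0 T).toFinset, (1 : ℤ) := by simp
      _ ≤ ∑ ρ ∈ (zetaZeroBox_finite 0 T).toFinset, riemannZetaZeroOrder ρ :=
          Finset.sum_le_sum fun ρ hρ ↦ by have := hpos ρ hρ; omega
  exact_mod_cast h

open scoped ComplexConjugate in
/-- **`2N(T) − N⊛(T) ≤ N⁽¹⁾(T)`, unconditionally.** With `c(v) = #{n < N(T) : γ_n = v}`:
`N⊛(T) = Σ_ρ m(ρ)c(Im ρ)`, `N(T) = Σ_ρ m(ρ)` over the distinct zeros of the box (ordinate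
dictionary), and zero by zero `m(ρ)c(Im ρ) ≥ 2m(ρ) − [Re ρ = ½ ∧ m(ρ) = 1]`, because
`c(Im ρ) ≥ m(ρ)`, and `c(Im ρ) ≥ m(ρ) + m(1 − ρ̄) = 2m(ρ)` when `Re ρ ≠ ½` (the reflected zero has
the same height and multiplicity, Titchmarsh §2.12). (Montgomery 1973, §3 runs this count under RH
with `Σ m_ρ²`; GLSS 2026 use `N⊛ ≥ N*` for Corollary 1.) [cite: Montgomery1973, §3] -/
theorem two_mul_zetaZeroCount_sub_coincidentPairCount_le (T : ℝ) :
    (2 * zetaZeroCount T : ℤ) - coincidentPairCount T ≤ simpleCriticalZeroCount T := by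
  classical
  set B : Finset ℂ := (zetaZeroBox_finite 0 T).toFinset with hB
  set R : Finset ℕ := Finset.range (zetaZeroCount T) with hR
  obtain ⟨c, hc⟩ : ∃ c : ℝ → ℕ, ∀ v, c v = (R.filter fun n ↦ zetaOrdinate n = v).card :=
    ⟨_, fun _ ↦ rfl⟩
  have hmemB : ∀ ρ, ρ ∈ B ↔ ρ ∈ zetaZeroBox 0 T := fun ρ ↦ Set.Finite.mem_toFinset _
  have hpos : ∀ ρ ∈ B, 0 < riemannZetaZeroOrder ρ := fun ρ hρ ↦
    DiophantineGeometry.riemannZetaZeroOrder_pos_of_mem_zetaZeroBox ((hmemB ρ).1 hρ)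
  -- (a) `c(v) = Σ_{ρ ∈ B, Im ρ = v} m(ρ)` (ordinate dictionary, one height at a time)
  have hcv : ∀ v : ℝ, (c v : ℤ) = ∑ ρ ∈ B.filter (fun ρ ↦ ρ.im = v), riemannZetaZeroOrder ρ := by
    intro v
    rw [hc, hR, Montgomery.card_filter_zetaOrdinate_eq T v]
    have hfin : {ρ | ρ ∈ zetaZeroBox 0 T ∧ ρ.im = v}.Finite :=
      (zetaZeroBox_finite 0 T).subset fun ρ h ↦ h.1
    rw [finsum_mem_eq_finite_toFinset_sum _ hfin]
    refine Finset.sum_congr ?_ fun _ _ ↦ rfl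
    ext ρ
    simp [hB]
  -- (b) `N⊛(T) = Σ_{i < N(T)} c(γ_i)`
  have hD : (coincidentPairCount T : ℤ) = ∑ i ∈ R, (c (zetaOrdinate i) : ℤ) := by
    unfold coincidentPairCount
    rw [Finset.card_filter, zeroIndexSet, Finset.sum_product]
    push_cast
    refine Finset.sum_congr rfl fun i _ ↦ ?_
    rw [hc, Finset.card_filter]
    push_cast
    exact Finset.sum_congr rfl fun j _ ↦ if_congr eq_comm rfl rfl
  -- (c) `Σ_{i < N(T)} f(γ_i) = Σ_{ρ ∈ B} m(ρ) f(Im ρ)` (ordinate dictionary), hence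
  --     `N⊛(T) = Σ_ρ m(ρ) c(Im ρ)` and `N(T) = Σ_ρ m(ρ)`
  have hdict : ∀ f : ℝ → ℤ,
      ∑ i ∈ R, f (zetaOrdinate i) = ∑ ρ ∈ B, riemannZetaZeroOrder ρ * f ρ.im := by
    intro f
    have h := Montgomery.finsum_zetaZeroBox_mul_eq_sum_range (fun v ↦ ((f v : ℤ) : ℂ)) T
    rw [finsum_mem_eq_finite_toFinset_sum _ (zetaZeroBox_finite 0 T)] at h
    exact_mod_cast h.symm
  have hD' : (coincidentPairCount T : ℤ) = ∑ ρ ∈ B, riemannZetaZeroOrder ρ * (c ρ.im : ℤ) :=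
    hD.trans (hdict fun v ↦ (c v : ℤ))
  have hN : (zetaZeroCount T : ℤ) = ∑ ρ ∈ B, riemannZetaZeroOrder ρ := by
    rw [zetaZeroCount_eq_finsum, finsum_mem_eq_finite_toFinset_sum _ (zetaZeroBox_finite 0 T)]
  -- (d) zero by zero: `2 m(ρ) − [Re ρ = ½ ∧ m(ρ) = 1] ≤ m(ρ) c(Im ρ)`
  have hkey : ∀ ρ ∈ B, 2 * riemannZetaZeroOrder ρ -
      (if ρ.re = 1 / 2 ∧ riemannZetaZeroOrder ρ = 1 then (1 : ℤ) else 0) ≤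
        riemannZetaZeroOrder ρ * (c ρ.im : ℤ) := by
    intro ρ hρ
    have hρbox : ρ ∈ zetaZeroBox 0 T := (hmemB ρ).1 hρ
    have hm : 0 < riemannZetaZeroOrder ρ := hpos ρ hρ
    have hρfib : ρ ∈ B.filter (fun ρ' ↦ ρ'.im = ρ.im) := Finset.mem_filter.2 ⟨hρ, rfl⟩
    have hc1 : riemannZetaZeroOrder ρ ≤ c ρ.im := by
      rw [hcv]
      exact Finset.single_le_sum (f := riemannZetaZeroOrder)
        (fun ρ' hρ' ↦ (hpos ρ' (Finset.mem_filter.1 hρ').1).le) hρfib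
    by_cases hline : ρ.re = 1 / 2
    · by_cases h1 : riemannZetaZeroOrder ρ = 1
      · rw [if_pos ⟨hline, h1⟩]
        rw [h1] at hc1 ⊢
        linarith
      · rw [if_neg fun h ↦ h1 h.2]
        have hm2 : 2 ≤ riemannZetaZeroOrder ρ := by omega
        nlinarith [hc1, hm]
    · rw [if_neg fun h ↦ hline h.1]
      -- the reflected zero `ρ' = 1 − ρ̄ ≠ ρ` lies in the same fibre, with the same multiplicity
      obtain ⟨hζ, -, -, him0, himT⟩ := hρbox
      have hre0 : 0 < ρ.re := DiophantineGeometry.re_pos_of_riemannZeta_eq_zero hζ him0.ne'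
      have hre1 : ρ.re < 1 := DiophantineGeometry.re_lt_one_of_riemannZeta_eq_zero hζ
      have hord : riemannZetaZeroOrder (1 - conj ρ) = riemannZetaZeroOrder ρ :=
        riemannZetaZeroOrder_one_sub_conj hre0 hre1
      have hre' : (1 - conj ρ).re = 1 - ρ.re := by simp
      have him' : (1 - conj ρ).im = ρ.im := by simp
      have hne1 : 1 - conj ρ ≠ 1 := by
        intro h
        have := congrArg Complex.im h
        rw [him'] at this
        simp at this
        linarith
      have hζ' : riemannZeta (1 - conj ρ) = 0 :=
        (riemannZetaZeroOrder_pos_iff hne1).1 (by rw [hord]; exact hm)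
      have hρ'B : 1 - conj ρ ∈ B :=
        (hmemB _).2 ⟨hζ', by rw [hre']; linarith, by rw [hre']; linarith,
          by rw [him']; exact him0, by rw [him']; exact himT⟩
      have hne : 1 - conj ρ ≠ ρ := by
        intro h
        have := congrArg Complex.re h
        rw [hre'] at this
        apply hline
        linarith
      have hc2 : riemannZetaZeroOrder ρ + riemannZetaZeroOrder (1 - conj ρ) ≤ c ρ.im := by
        rw [hcv, ← Finset.sum_pair hne.symm]
        refine Finset.sum_le_sum_of_subset_of_nonneg ?_ ?_
        · intro x hx
          rw [Finset.mem_insert, Finset.mem_singleton] at hx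
          rcases hx with rfl | rfl
          · exact hρfib
          · exact Finset.mem_filter.2 ⟨hρ'B, him'⟩
        · intro x hx _
          exact (hpos x (Finset.mem_filter.1 hx).1).le
      rw [hord] at hc2
      nlinarith [hc2, hm]
  -- (e) sum over the distinct zeros of the box
  have hsum := Finset.sum_le_sum hkey
  rw [Finset.sum_sub_distrib, ← Finset.mul_sum, ← hN, ← hD', Finset.sum_boole] at hsum
  rw [simpleCriticalZeroCount_eq_card_filter, ← hB]
  linarith [hsum]

/-- **(ES1) alone ⇒ asymptotically 100% of the zeros of `ζ` are simple and on the critical line**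
(no RH, no AH): `2 − N⊛(T)/N(T) ≤ N⁽¹⁾(T)/N(T) ≤ 1` (`two_mul_zetaZeroCount_sub_coincidentPairCount_le`)
and `N⊛(T)/N(T) = (N⊛/TL)/(N/TL) → 1` under (ES1). This is the content of GLSS 2026, Corollary 1
once `p_0 = 1` has been turned into ESH. [cite: GoldstonLeeSchettlerSuriajaya2026, §1 Corollary 1] -/
theorem almostAllSimpleOnLine_of_ES1 (h : ES1) : AlmostAllSimpleOnLine := by
  have hN := tendsto_zetaZeroCount_div_mul_L
  have hT1 : ∀ᶠ T : ℝ in atTop, 1 < T := eventually_gt_atTop 1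
  have hNpos : ∀ᶠ T : ℝ in atTop, (0 : ℝ) < zetaZeroCount T := by
    have hN' : Tendsto zetaZeroCount atTop atTop := tendsto_zetaZeroCount_atTop_holds
    exact (hN'.eventually_gt_atTop 0).mono fun T hT ↦ by exact_mod_cast hT
  -- `N⊛/N → 1`
  have hratio : Tendsto (fun T : ℝ ↦ (coincidentPairCount T : ℝ) / zetaZeroCount T)
      atTop (𝓝 1) := by
    have h' := h.div hN one_ne_zero
    rw [div_one] at h'
    refine h'.congr' ?_
    filter_upwards [hT1, hNpos] with T hT hNT
    have hTL : T * L T ≠ 0 := (mul_pos (by linarith) (L_pos hT)).ne'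
    rw [Pi.div_apply, div_div_div_cancel_right₀ hTL]
  refine tendsto_of_tendsto_of_tendsto_of_le_of_le'
    (g := fun T ↦ 2 - (coincidentPairCount T : ℝ) / zetaZeroCount T) (h := fun _ ↦ 1) ?_
    tendsto_const_nhds ?_ ?_
  · have h2 := hratio.const_sub 2
    norm_num at h2
    exact h2
  · filter_upwards [hNpos] with T hNT
    have hle := two_mul_zetaZeroCount_sub_coincidentPairCount_le T
    have hle' : (2 * zetaZeroCount T : ℝ) - coincidentPairCount T ≤ simpleCriticalZeroCount T := by
      exact_mod_cast hle
    rw [le_div_iff₀ hNT, sub_mul, div_mul_cancel₀ _ hNT.ne']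
    linarith
  · filter_upwards [hNpos] with T hNT
    rw [div_le_one hNT]
    exact_mod_cast simpleCriticalZeroCount_le_zetaZeroCount T

/-- `p_0 = 1` for some bin half-width `δ > 0` gives 100% simple zeros on the critical line,
unconditionally (Parts D–E with `essentialSimplicity_of_hasLimitingDensity_one`).
[cite: GoldstonLeeSchettlerSuriajaya2026, §1 Corollary 1] -/
theorem almostAllSimpleOnLine_of_hasLimitingDensity_one {δ : ℝ} (hδ : 0 < δ)
    (h : AH.HasLimitingDensity 0 δ 1) : AlmostAllSimpleOnLine :=
  almostAllSimpleOnLine_of_ES1 (esh_of_hasLimitingDensity_one hδ h).1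

/-- The tree's ESH (Mueller 1983 / Ivić 2002 form) gives 100% simple zeros on the critical line,
unconditionally. [cite: Ivic2002SmallValues, (32)–(33)] -/
theorem almostAllSimpleOnLine_of_essentialSimplicityHypothesis (h : EssentialSimplicityHypothesis) :
    AlmostAllSimpleOnLine :=
  almostAllSimpleOnLine_of_ES1 (esh_of_essentialSimplicityHypothesis h).1

end GLSS2026

/-- **GLSS 2026, Corollary 1 — DISCHARGED** ("Assuming AH-Pairs, if `p_0 = 1`, then asymptotically
100% of the zeros of `ζ(s)` are simple and on the critical line"): the named fact
`glss2026_corollary1` is a theorem of the tree, and the AH-Pairs hypothesis is not used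
(`glss2026_theorem1_mp_unconditional`, `GLSS2026.almostAllSimpleOnLine_of_ES1`).
[cite: GoldstonLeeSchettlerSuriajaya2026, §1 Corollary 1] -/
theorem glss2026_corollary1_holds : glss2026_corollary1 := fun _ h ↦
  GLSS2026.almostAllSimpleOnLine_of_ES1 (glss2026_theorem1_mp_unconditional h).1

/-- **GLSS 2026, Theorem 4 from Theorem 3 alone** (Corollary 1 being a theorem of the tree):
`glss2026_theorem3 → glss2026_theorem4`. [cite: GoldstonLeeSchettlerSuriajaya2026, Theorem 4] -/
theorem glss2026_theorem4_of_theorem3 (h3 : glss2026_theorem3) : glss2026_theorem4 :=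
  glss2026_theorem4_of_theorem3_of_corollary1 h3 glss2026_corollary1_holds

/-- BGSTB 2025, Theorem 2 route to 100% simple zeros on the line: `bgstb2025_theorem2` (claim), RH
and Strong AH-Pairs give `N⁽¹⁾(T)/N(T) → 1`. [cite: BaluyotGoldstonSuriajayaTurnageButterbaugh2025, Theorem 2] -/
theorem GLSS2026.almostAllSimpleOnLine_of_bgstb2025_theorem2 (h : bgstb2025_theorem2)
    (hRH : RiemannHypothesis) (hS : StrongAHPairs) : GLSS2026.AlmostAllSimpleOnLine :=
  GLSS2026.almostAllSimpleOnLine_of_ES1 (GLSS2026.esh_of_bgstb2025_theorem2 h hRH hS).1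

/-! ## Part F: `limsup P_0 ≤ 3/2` gives 50% simple zeros on the line — GLSS 2026 Corollary 2 from
Theorem 3, both halves (appended 2026-08-26)

Coincident pairs whose ordinates both exceed `T/log²T` lie in the diagonal bin `B_0(T, M, δ)`
(their normalised difference is `0`); the others are `O(T)` by the local density of the zeros
(`AH.card_pairs_offWindow_le`, `N(u + 1) − N(u) ≪ log(|u| + 2)` and `N(T/log²T + 1) ≪ T/log T`,
all proved in the tree — the bookkeeping of `essentialSimplicity_of_hasLimitingDensity_one`). So
`N⊛(T) ≤ |B_0(T, M, δ)| + C T` (`GLSS2026.exists_coincidentPairCount_le_bin_add`), and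
`limsup P_0(T) ≤ 3/2` gives `N⊛(T) ≤ (3/2 + ε)N(T)`, whence by Part E
`N⁽¹⁾(T) ≥ 2N − N⊛ ≥ (1/2 − ε)N(T)`: at least 50% of the zeros are simple AND on the line
(`GLSS2026.halfSimpleHalfOnLine_of_dens_le`; GLSS 2026, §4 argue via `N_s, N_0 ≥ 2N − N*`). With
the density half already derived from Theorem 3 (`glss2026_corollary2_limsup_of_theorem3`):
`glss2026_corollary2_of_theorem3 : glss2026_theorem3 → glss2026_corollary2`. -/

namespace GLSS2026

/-- **Coincident pairs versus the diagonal bin.** For `M ≥ 0` and `δ > 0` there are `C, T₀` with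
`N⊛(T) ≤ |B_0(T, M, δ)| + C·T` for all `T ≥ T₀`: a coincident pair with both ordinates `> T/log²T`
has normalised difference `0 ∈ (−δ/2, δ/2]` and lies in `B_0`; the pairs with a member `≤ T/log²T`
number `≤ N(T/log²T + 1) · 3C₀ log(T + 4) ≤ C T`. [cite: BaluyotGoldstonSuriajayaTurnageButterbaugh2025, §3 (zeropairbound)] -/
theorem exists_coincidentPairCount_le_bin_add {M δ : ℝ} (hM : 0 ≤ M) (hδ : 0 < δ) :
    ∃ C T₀ : ℝ, ∀ T : ℝ, T₀ ≤ T →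
      (coincidentPairCount T : ℝ) ≤ (AH.bin 0 T M δ).card + C * T := by
  classical
  obtain ⟨C₀, hC₀, hW⟩ := Montgomery.exists_zetaZeroCount_window_le
  obtain ⟨CN, hCN, hN⟩ := AH.exists_zetaZeroCount_le_mul_log
  have ev : ∀ᶠ T : ℝ in atTop, 8 ≤ T ∧ Real.log T ^ 2 / (1 * T + 0) ≤ 1 / 2 :=
    (eventually_ge_atTop 8).and
      ((Real.tendsto_pow_log_div_mul_add_atTop 1 0 2 one_ne_zero).eventually_le_const
        (by norm_num))
  obtain ⟨T₀, hT₀⟩ := Filter.eventually_atTop.mp ev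
  refine ⟨12 * CN * C₀, T₀, fun T hT ↦ ?_⟩
  obtain ⟨hT8, h3⟩ := hT₀ T hT
  have hTpos : 0 < T := by linarith
  have hlogT : 2 ≤ Real.log T := by
    have : Real.log 8 = 3 * Real.log 2 := by
      rw [show (8 : ℝ) = 2 ^ 3 by norm_num, Real.log_pow]; norm_num
    have h8 : Real.log 8 ≤ Real.log T := Real.log_le_log (by norm_num) hT8
    linarith [Real.log_two_gt_d9]
  have hlogpos : 0 < Real.log T := by linarith
  -- the window threshold `L = T / log² T`, with `2 ≤ L` and `L + 1 ≤ T`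
  set L : ℝ := T / Real.log T ^ 2 with hL
  have hL2 : 2 * Real.log T ^ 2 ≤ T := by
    rw [one_mul, add_zero, div_le_iff₀ hTpos] at h3
    linarith
  have hLge : 2 ≤ L := by
    rw [hL, le_div_iff₀ (by positivity)]
    linarith
  have hL1T : L + 1 ≤ T := by
    have : L ≤ T / 2 := by
      rw [hL]
      exact div_le_div_of_nonneg_left hTpos.le (by norm_num) (by nlinarith)
    linarith
  -- split `N⊛(T)` along "both ordinates > L"
  set S := zeroIndexSet T with hS
  set coin : ℕ × ℕ → Prop := fun p ↦ zetaOrdinate p.1 = zetaOrdinate p.2 with hcoin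
  set win : ℕ × ℕ → Prop := fun p ↦ L < zetaOrdinate p.1 ∧ L < zetaOrdinate p.2 with hwin
  have hcount : (coincidentPairCount T : ℝ) =
      (((S ×ˢ S).filter coin).filter win).card +
        (((S ×ˢ S).filter coin).filter (fun p ↦ ¬ win p)).card := by
    rw [← Nat.cast_add, Finset.card_filter_add_card_filter_not]
    simp [coincidentPairCount, hS, hcoin]
  -- (I) window pairs lie in the diagonal bin
  have hI : ((S ×ˢ S).filter coin).filter win ⊆ AH.bin 0 T M δ := by
    intro p hp
    simp only [Finset.mem_filter, hcoin, hwin] at hp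
    obtain ⟨⟨hpS, hc⟩, hw1, hw2⟩ := hp
    have hx : AH.pairSpacing T p = 0 := by
      unfold AH.pairSpacing
      rw [hc, sub_self, zero_mul, zero_div]
    rw [AH.mem_bin, AH.mem_pairs]
    refine ⟨⟨hpS, hw1, hw2, by rw [hx, abs_zero]; exact hM⟩, ?_, ?_⟩
    · rw [hx]; push_cast; linarith
    · rw [hx]; push_cast; linarith
  have hIcard : ((((S ×ˢ S).filter coin).filter win).card : ℝ) ≤ (AH.bin 0 T M δ).card := by
    exact_mod_cast Finset.card_le_card hI
  -- (II) off-window pairs are `O(T)`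
  have hII : ((((S ×ˢ S).filter coin).filter (fun p ↦ ¬ win p)).card : ℝ) ≤ 12 * CN * C₀ * T := by
    have hA : ((S ×ˢ S).filter coin).filter (fun p ↦ ¬ win p) ⊆ S ×ˢ S :=
      (Finset.filter_subset _ _).trans (Finset.filter_subset _ _)
    have hcl : ∀ p ∈ ((S ×ˢ S).filter coin).filter (fun p ↦ ¬ win p),
        |zetaOrdinate p.1 - zetaOrdinate p.2| ≤ 1 := by
      intro p hp
      simp only [Finset.mem_filter, hcoin] at hp
      rw [hp.1.2, sub_self, abs_zero]
      exact zero_le_one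
    have hoff : ∀ p ∈ ((S ×ˢ S).filter coin).filter (fun p ↦ ¬ win p),
        zetaOrdinate p.1 ≤ L ∨ zetaOrdinate p.2 ≤ L := by
      intro p hp
      simp only [Finset.mem_filter, hwin, not_and_or, not_lt] at hp
      exact hp.2
    have hb := AH.card_pairs_offWindow_le hC₀.le hW hTpos.le hA hcl hoff
    have hNL : (zetaZeroCount (L + 1) : ℝ) ≤ CN * ((L + 1) * Real.log (L + 1)) :=
      hN (L + 1) (by linarith)
    have hlogL : Real.log (L + 1) ≤ Real.log T := Real.log_le_log (by linarith) hL1T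
    have hlogT4 : Real.log (T + 4) ≤ 2 * Real.log T := by
      rw [show 2 * Real.log T = Real.log (T ^ 2) by rw [Real.log_pow]; norm_num]
      exact Real.log_le_log (by linarith) (by nlinarith)
    have hLT : (L + 1) * Real.log T ^ 2 ≤ 2 * T := by
      have : L * Real.log T ^ 2 = T := by
        rw [hL]; field_simp
      nlinarith [sq_nonneg (Real.log T)]
    have hlogL0 : 0 ≤ Real.log (L + 1) := Real.log_nonneg (by linarith)
    have hlog4 : 0 ≤ Real.log (T + 4) := Real.log_nonneg (by linarith)
    have hT4 : 0 ≤ 3 * C₀ * Real.log (T + 4) := by positivity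
    have hNL0 : 0 ≤ CN * ((L + 1) * Real.log (L + 1)) :=
      mul_nonneg hCN.le (mul_nonneg (by linarith) hlogL0)
    calc ((((S ×ˢ S).filter coin).filter (fun p ↦ ¬ win p)).card : ℝ)
        ≤ zetaZeroCount (L + 1) * (3 * C₀ * Real.log (T + 4)) := hb
      _ ≤ CN * ((L + 1) * Real.log (L + 1)) * (3 * C₀ * (2 * Real.log T)) :=
          mul_le_mul hNL (by gcongr) hT4 hNL0
      _ ≤ CN * ((L + 1) * Real.log T) * (3 * C₀ * (2 * Real.log T)) := by
          gcongr
      _ = 6 * CN * C₀ * ((L + 1) * Real.log T ^ 2) := by ring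
      _ ≤ 6 * CN * C₀ * (2 * T) := by gcongr
      _ = 12 * CN * C₀ * T := by ring
  rw [hcount]
  linarith

/-- `1/L(T) → 0`. [cite: GoldstonLeeSchettlerSuriajaya2026, §1 eq. (1.1)] -/
theorem tendsto_inv_L : Tendsto (fun T : ℝ ↦ (L T)⁻¹) atTop (𝓝 0) := by
  have hL : Tendsto L atTop atTop := by
    unfold L
    exact Real.tendsto_log_atTop.atTop_div_const (by positivity)
  exact hL.inv_tendsto_atTop

/-- `N⁽¹⁾(T) ≤ N_s(T)`: a simple zero on the line is a simple zero. [cite: BuiHeathbrown2013, §1] -/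
theorem simpleCriticalZeroCount_le_simpleZeroCount (T : ℝ) :
    simpleCriticalZeroCount T ≤ simpleZeroCount T := by
  unfold simpleCriticalZeroCount simpleZeroCount
  refine Set.ncard_le_ncard ?_ ((zetaZeroBox_finite 0 T).subset fun ρ h ↦ h.1)
  rintro ρ ⟨⟨h0, h1, h2, h3, h4⟩, h5, h6⟩
  exact ⟨⟨h0, by rw [h5]; norm_num, h2, h3, h4⟩, h6⟩

/-- **`limsup P_0(T) ≤ 3/2` ⇒ at least 50% of the zeros are simple and on the critical line.** If
for every `ε > 0` eventually `P_0(T) ≤ 3/2 + ε` (the `M`-free density `dens 0 T`, bins of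
half-width `½`), then for every `ε > 0` eventually `(1/2 − ε) N(T) ≤ N⁽¹⁾(T)` — by
`N⊛(T) ≤ |B_0| + O(T)`, `N ∼ TL` and `N⁽¹⁾ ≥ 2N − N⊛` (Part E).
[cite: GoldstonLeeSchettlerSuriajaya2026, §1 Corollary 2 and §4] -/
theorem eventually_simpleCritical_ge_of_dens_le
    (h : ∀ ε : ℝ, 0 < ε → ∀ᶠ T : ℝ in atTop, dens 0 T ≤ 3 / 2 + ε) :
    ∀ ε : ℝ, 0 < ε → ∀ᶠ T : ℝ in atTop,
      (1 / 2 - ε) * (zetaZeroCount T : ℝ) ≤ simpleCriticalZeroCount T := by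
  intro ε hε
  -- `N⊛ ≤ |B_0(T, 1/4, 1/2)| + C T`
  obtain ⟨C, T₀, hC⟩ := exists_coincidentPairCount_le_bin_add (M := 1 / 4) (δ := 1 / 2)
    (by norm_num) (by norm_num)
  have hN := tendsto_zetaZeroCount_div_mul_L
  have hT1 : ∀ᶠ T : ℝ in atTop, 1 < T := eventually_gt_atTop 1
  have hNpos : ∀ᶠ T : ℝ in atTop, (0 : ℝ) < zetaZeroCount T := by
    have hN' : Tendsto zetaZeroCount atTop atTop := tendsto_zetaZeroCount_atTop_holds
    exact (hN'.eventually_gt_atTop 0).mono fun T hT ↦ by exact_mod_cast hT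
  -- `TL/N → 1` and `T/N → 0`
  have hTLN : Tendsto (fun T : ℝ ↦ T * L T / zetaZeroCount T) atTop (𝓝 1) := by
    have h' := hN.inv₀ one_ne_zero
    rw [inv_one] at h'
    refine h'.congr' ?_
    filter_upwards [hT1] with T hT
    rw [inv_div]
  have hTN : Tendsto (fun T : ℝ ↦ T / zetaZeroCount T) atTop (𝓝 0) := by
    have h' := hTLN.mul tendsto_inv_L
    rw [one_mul] at h'
    refine h'.congr' ?_
    filter_upwards [hT1] with T hT
    have hL : L T ≠ 0 := (L_pos hT).ne'
    field_simp
  -- the combination `((3/2 + ε/4) TL + C T)/N → 3/2 + ε/4 < 3/2 + ε/2`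
  have hcomb : Tendsto (fun T : ℝ ↦ (3 / 2 + ε / 4) * (T * L T / zetaZeroCount T) +
      C * (T / zetaZeroCount T)) atTop (𝓝 ((3 / 2 + ε / 4) * 1 + C * 0)) :=
    (hTLN.const_mul _).add (hTN.const_mul C)
  have hlt : (3 / 2 + ε / 4) * 1 + C * 0 < 3 / 2 + ε / 2 := by linarith
  have hdens : ∀ᶠ T : ℝ in atTop, dens 0 T ≤ 3 / 2 + ε / 4 := h (ε / 4) (by positivity)
  filter_upwards [hdens, hcomb.eventually (gt_mem_nhds hlt), eventually_ge_atTop T₀, hT1, hNpos]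
    with T hd hc hT₀ hT1' hNT
  have hTL : 0 < T * L T := mul_pos (by linarith) (L_pos hT1')
  -- `|B_0| = dens 0 T · (T L)`
  have hbin : ((AH.bin 0 T (1 / 4) (1 / 2)).card : ℝ) = dens 0 T * (T * L T) := by
    have hd' : dens 0 T = AH.binDensity 0 T (1 / 4) (1 / 2) := by
      rw [dens]; norm_num
    rw [hd', AH.binDensity, mul_L, div_mul_cancel₀]
    rw [← mul_L]
    exact hTL.ne'
  have h1 : (coincidentPairCount T : ℝ) ≤ (3 / 2 + ε / 4) * (T * L T) + C * T := by
    have := hC T hT₀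
    rw [hbin] at this
    nlinarith [hd, hTL]
  have h2 : (3 / 2 + ε / 4) * (T * L T) + C * T < (3 / 2 + ε / 2) * zetaZeroCount T := by
    have hN0 : (zetaZeroCount T : ℝ) ≠ 0 := hNT.ne'
    have e : (3 / 2 + ε / 4) * (T * L T / zetaZeroCount T) + C * (T / zetaZeroCount T) =
        ((3 / 2 + ε / 4) * (T * L T) + C * T) / zetaZeroCount T := by
      field_simp
    rw [e, div_lt_iff₀ hNT] at hc
    exact hc
  have h3 := two_mul_zetaZeroCount_sub_coincidentPairCount_le T
  have h3' : (2 * zetaZeroCount T : ℝ) - coincidentPairCount T ≤ simpleCriticalZeroCount T := by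
    exact_mod_cast h3
  have h4 : 0 ≤ ε * (zetaZeroCount T : ℝ) := by positivity
  linarith

/-- **`limsup P_0(T) ≤ 3/2` ⇒ "at least 50% of the zeros are simple and at least 50% are on the
critical line"** (`HalfSimpleHalfOnLine`), since `N_s(T), N_0(T) ≥ N⁽¹⁾(T)`.
[cite: GoldstonLeeSchettlerSuriajaya2026, §1 Corollary 2 and §4] -/
theorem halfSimpleHalfOnLine_of_dens_le
    (h : ∀ ε : ℝ, 0 < ε → ∀ᶠ T : ℝ in atTop, dens 0 T ≤ 3 / 2 + ε) : HalfSimpleHalfOnLine := by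
  intro ε hε
  filter_upwards [eventually_simpleCritical_ge_of_dens_le h ε hε] with T hT
  have hs : (simpleCriticalZeroCount T : ℝ) ≤ simpleZeroCount T := by
    exact_mod_cast simpleCriticalZeroCount_le_simpleZeroCount T
  have hc : (simpleCriticalZeroCount T : ℝ) ≤ criticalZeroCount T := by
    exact_mod_cast simpleCriticalZeroCount_le_criticalZeroCount T
  exact ⟨hT.trans hs, hT.trans hc⟩

end GLSS2026

/-- **GLSS 2026, Corollary 2 from Theorem 3 — both halves** ("Assuming AH-Pairs and (AH1),
`limsup P_0(T) ≤ 3/2` and asymptotically at least 50% of the zeros are simple and at least 50% are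
on the critical line"): the density half is `glss2026_corollary2_limsup_of_theorem3`, the
zero-counting half follows from it unconditionally (`GLSS2026.halfSimpleHalfOnLine_of_dens_le`).
[cite: GoldstonLeeSchettlerSuriajaya2026, Corollary 2] -/
theorem glss2026_corollary2_of_theorem3 (h3 : glss2026_theorem3) : glss2026_corollary2 :=
  fun hAH hW ↦
    ⟨glss2026_corollary2_limsup_of_theorem3 h3 hAH hW,
      GLSS2026.halfSimpleHalfOnLine_of_dens_le (glss2026_corollary2_limsup_of_theorem3 h3 hAH hW)⟩


/-! ## Part G: GLSS 2026, Theorem 1 — DISCHARGED (appended 2026-08-26, seat t6 g3)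

GLSS, §2, proof of Theorem 1: assuming AH-Pairs at level `M` (data `R`, `C₀`), for large `T`
`P_0(T)·TL = |B_0(T)| = #{(γ,γ') ∈ 𝒫(T,M) : |(γ−γ')L| ≤ C₀R(T)} = N⊛(T) + 2N(T, C₀R(T)) + O(T/L)`;
ESH makes the right-hand side `TL + o(TL)`. Here: the localisation of `B_0` by AH-Pairs
(`eventually_abs_pairSpacing_le_of_mem_bin_zero`), the upper bound `|B_0| ≤ N⊛ + 2N(T, |C|R)`
(no switch needed) and the lower bound `N⊛ − O(T) ≤ |B_0|` of Part F give `P_0(T, M, ½) → 1`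
(`tendsto_binDensity_zero_of_esh`), at every level `M > 0`; with Part D's unconditional converse,
**`glss2026_theorem1_holds : glss2026_theorem1`**. -/

namespace GLSS2026


/-- Bins grow with the level: `B_{k/2}(T, M, δ) ⊆ B_{k/2}(T, M', δ)` for `M ≤ M'`
(`𝒫(T, M) ⊆ 𝒫(T, M')`). [cite: BaluyotGoldstonSuriajayaTurnageButterbaugh2025, §1 (B_{k/2})] -/
theorem bin_mono (k : ℤ) (T δ : ℝ) {M M' : ℝ} (h : M ≤ M') : AH.bin k T M δ ⊆ AH.bin k T M' δ := by
  intro p hp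
  rw [AH.mem_bin] at hp ⊢
  exact ⟨AH.pairs_mono h hp.1, hp.2.1, hp.2.2⟩

/-- `P_{k/2}(T, M, δ) = |B_{k/2}(T, M, δ)|/(T L)`. [cite: GoldstonLeeSchettlerSuriajaya2026, §1 eq. (1.11)] -/
theorem binDensity_eq_card_div (k : ℤ) (T M δ : ℝ) :
    AH.binDensity k T M δ = ((AH.bin k T M δ).card : ℝ) / (T * L T) := by
  rw [AH.binDensity, mul_L]

/-- **AH-Pairs localises the diagonal bin** (GLSS 2026, proof of Theorem 1, §2, first display:
"`|B_0(T)| = Σ_{(γ,γ') ∈ 𝒫(T,M), −1/4 < (γ−γ')L ≤ 1/4} 1 = Σ_{(γ,γ') ∈ 𝒫(T,M), |(γ−γ')L| ≤ C₀R(T)} 1`"):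
if `(R, C)` is an AH-Pairs witness at level `M`, then for all large `T` every pair of
`B_0(T, M, ½)` has `|((γ − γ')/2π) log T| ≤ |C| R(T)` — its nearest half-integer `k/2` is `0`,
because `|x| ≤ 1/4` and `|x − k/2| ≤ C(|k| + 1)R(T) < |k|/4` is impossible for `k ≠ 0` once
`8|C|R(T) < 1`. [cite: GoldstonLeeSchettlerSuriajaya2026, §2 (proof of Theorem 1, display (2.2))] -/
theorem eventually_abs_pairSpacing_le_of_mem_bin_zero {M : ℝ} {R : ℝ → ℝ} {C : ℝ}
    (h : IsAHPairsWitness M R C) :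
    ∀ᶠ T : ℝ in atTop, ∀ p ∈ AH.bin 0 T M (1 / 2), |AH.pairSpacing T p| ≤ |C| * R T := by
  obtain ⟨hR0, -, hRt, hev⟩ := h
  have hsmall : ∀ᶠ T : ℝ in atTop, 8 * |C| * R T < 1 := by
    have : Tendsto (fun T ↦ 8 * |C| * R T) atTop (𝓝 0) := by
      simpa using hRt.const_mul (8 * |C|)
    exact this.eventually (gt_mem_nhds one_pos)
  filter_upwards [hev, hsmall] with T hT hsT p hp
  obtain ⟨hpP, h1, h2⟩ := AH.mem_bin.mp hp
  obtain ⟨k, hk⟩ := hT p hpP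
  have hRT : 0 ≤ R T := (hR0 T).le
  have hx : |AH.pairSpacing T p| ≤ 1 / 4 := by
    push_cast at h1 h2
    rw [abs_le]
    constructor <;> linarith
  by_cases hk0 : k = 0
  · subst hk0
    simp only [Int.cast_zero, zero_div, sub_zero, abs_zero, zero_add, mul_one] at hk
    exact hk.trans (mul_le_mul_of_nonneg_right (le_abs_self C) hRT)
  · exfalso
    have hk1 : (1 : ℝ) ≤ |(k : ℝ)| := by
      rw [← Int.cast_abs]
      exact_mod_cast Int.one_le_abs hk0
    have hlow : |(k : ℝ)| / 4 ≤ |AH.pairSpacing T p - k / 2| := by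
      have h3 := abs_sub_abs_le_abs_sub ((k : ℝ) / 2) (AH.pairSpacing T p)
      rw [abs_sub_comm] at h3
      have hk2 : |(k : ℝ) / 2| = |(k : ℝ)| / 2 := by
        rw [abs_div, abs_two]
      linarith
    have hup : C * (|(k : ℝ)| + 1) * R T ≤ 2 * |C| * |(k : ℝ)| * R T := by
      calc C * (|(k : ℝ)| + 1) * R T ≤ |C| * (|(k : ℝ)| + 1) * R T := by
            gcongr; exact le_abs_self C
        _ ≤ |C| * (2 * |(k : ℝ)|) * R T := by gcongr; linarith
        _ = 2 * |C| * |(k : ℝ)| * R T := by ring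
    have hlt : 2 * |C| * |(k : ℝ)| * R T < |(k : ℝ)| / 4 := by
      have hkpos : (0 : ℝ) < |(k : ℝ)| := by linarith
      have : 2 * |C| * |(k : ℝ)| * R T = (8 * |C| * R T) * (|(k : ℝ)| / 4) := by ring
      rw [this]
      exact mul_lt_of_lt_one_left (by positivity) hsT
    linarith

/-- **Upper bound for the diagonal bin under AH-Pairs**: for all large `T`,
`|B_0(T, M, ½)| ≤ N⊛(T) + 2N(T, |C|R(T))` — drop the constraint `γ, γ' > T/log²T` and split the
symmetric window `|(γ − γ')L| ≤ |C|R(T)` (`pairCorrelationCount_neg_eq`). (GLSS, display (2.2):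
"`= N⊛(T) + 2N(T, C₀R(T)) + O(T/L)`"; for the upper bound the `O(T/L)` switch is not needed.)
[cite: GoldstonLeeSchettlerSuriajaya2026, §2 (proof of Theorem 1, display (2.2))] -/
theorem eventually_card_bin_zero_le {M : ℝ} {R : ℝ → ℝ} {C : ℝ} (h : IsAHPairsWitness M R C) :
    ∀ᶠ T : ℝ in atTop, ((AH.bin 0 T M (1 / 2)).card : ℝ) ≤
      coincidentPairCount T + 2 * pairCount T (|C| * R T) := by
  have hR0 := h.1
  filter_upwards [eventually_abs_pairSpacing_le_of_mem_bin_zero h, eventually_gt_atTop 1]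
    with T hT hT1
  have hα : 0 ≤ |C| * R T := mul_nonneg (abs_nonneg _) (hR0 T).le
  have hlog : 0 < Real.log T := Real.log_pos hT1
  have key : (AH.bin 0 T M (1 / 2)).card ≤
      pairCorrelationCount (-(|C| * R T)) (|C| * R T) T := by
    classical
    unfold pairCorrelationCount
    refine Finset.card_le_card fun p hp ↦ ?_
    rw [Finset.mem_filter]
    refine ⟨(AH.mem_pairs.mp (AH.mem_bin.mp hp).1).1, ?_⟩
    have hx := abs_le.mp (hT p hp)
    unfold AH.pairSpacing at hx
    have e : (zetaOrdinate p.1 - zetaOrdinate p.2) * Real.log T / (2 * π) =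
        (zetaOrdinate p.1 - zetaOrdinate p.2) / (2 * π / Real.log T) := by
      field_simp
    rw [e, le_div_iff₀ (by positivity), div_le_iff₀ (by positivity)] at hx
    constructor
    · rw [show 2 * π * -(|C| * R T) / Real.log T = -(|C| * R T) * (2 * π / Real.log T) by ring]
      exact hx.1
    · rw [show 2 * π * (|C| * R T) / Real.log T = (|C| * R T) * (2 * π / Real.log T) by ring]
      exact hx.2
  calc ((AH.bin 0 T M (1 / 2)).card : ℝ)
      ≤ pairCorrelationCount (-(|C| * R T)) (|C| * R T) T := by exact_mod_cast key
    _ = coincidentPairCount T + 2 * pairCount T (|C| * R T) := by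
        rw [pairCorrelationCount_neg_eq T _ hT1 hα]; push_cast; ring

/-- **ESH ⇒ `P_0(T, M, ½) → 1` at every level `M ≥ 0` carrying AH-Pairs data** (GLSS 2026,
Theorem 1, direction ESH ⇒ `p_0 = 1`, proof §2): `N⊛(T) − O(T) ≤ |B_0| ≤ N⊛(T) + 2N(T, |C|R(T))`
(`exists_coincidentPairCount_le_bin_add`, `eventually_card_bin_zero_le`), and by (ES1), (ES2) with
`λ₀ = |C|R → 0`, both sides are `TL + o(TL)`.
[cite: GoldstonLeeSchettlerSuriajaya2026, §2 (proof of Theorem 1)] -/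
theorem tendsto_binDensity_zero_of_esh {M : ℝ} (hM : 0 ≤ M) {R : ℝ → ℝ} {C : ℝ}
    (h : IsAHPairsWitness M R C) (hE : ESH) :
    Tendsto (fun T : ℝ ↦ AH.binDensity 0 T M (1 / 2)) atTop (𝓝 1) := by
  obtain ⟨h1, h2⟩ := hE
  have hRt : Tendsto R atTop (𝓝 0) := h.2.2.1
  have hT1 : ∀ᶠ T : ℝ in atTop, 1 < T := eventually_gt_atTop 1
  obtain ⟨C', T₀, hlow⟩ := exists_coincidentPairCount_le_bin_add hM one_half_pos
  have hlam : Tendsto (fun T ↦ |C| * R T) atTop (𝓝 0) := by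
    simpa using hRt.const_mul |C|
  have h2' := h2 _ hlam
  -- lower and upper envelopes, both `→ 1`
  have hlo : Tendsto (fun T : ℝ ↦ (coincidentPairCount T : ℝ) / (T * L T) - C' * (L T)⁻¹)
      atTop (𝓝 1) := by
    simpa using h1.sub (tendsto_inv_L.const_mul C')
  have hhi : Tendsto (fun T : ℝ ↦ (coincidentPairCount T : ℝ) / (T * L T) +
      2 * ((pairCount T (|C| * R T) : ℝ) / (T * L T))) atTop (𝓝 1) := by
    simpa using h1.add (h2'.const_mul 2)
  refine tendsto_of_tendsto_of_tendsto_of_le_of_le' hlo hhi ?_ ?_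
  · filter_upwards [hT1, eventually_ge_atTop T₀] with T hT hTT₀
    have hTL : 0 < T * L T := mul_pos (by linarith) (L_pos hT)
    have hT0 : (T : ℝ) ≠ 0 := by positivity
    rw [binDensity_eq_card_div]
    have e : (coincidentPairCount T : ℝ) / (T * L T) - C' * (L T)⁻¹ =
        ((coincidentPairCount T : ℝ) - C' * T) / (T * L T) := by
      field_simp
    rw [e]
    exact div_le_div_of_nonneg_right (by linarith [hlow T hTT₀]) hTL.le
  · filter_upwards [hT1, eventually_card_bin_zero_le h] with T hT hup
    have hTL : 0 < T * L T := mul_pos (by linarith) (L_pos hT)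
    rw [binDensity_eq_card_div, ← mul_div_assoc, ← add_div]
    exact div_le_div_of_nonneg_right hup hTL.le

end GLSS2026

/-- **GLSS 2026, Theorem 1 — DISCHARGED** ("Assuming AH-Pairs, we have that `p_0 = 1` is
equivalent to ESH"): `→` is unconditional (`glss2026_theorem1_mp_unconditional`, Part D); `←` is
`GLSS2026.tendsto_binDensity_zero_of_esh` at every level `M > 0` (AH-Pairs supplies the data
`(R, C)` at each level). [cite: GoldstonLeeSchettlerSuriajaya2026, Theorem 1 (proof §2)] -/
theorem glss2026_theorem1_holds : glss2026_theorem1 := by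
  intro hAH
  refine ⟨glss2026_theorem1_mp_unconditional, fun hE ↦ ?_⟩
  unfold AH.HasLimitingDensity
  filter_upwards [eventually_gt_atTop 0] with M hM
  obtain ⟨R, C, hRC⟩ := (GLSS2026.ahPairsAt_iff M).mp (hAH M hM)
  exact GLSS2026.tendsto_binDensity_zero_of_esh hM.le hRC hE


/-! ## Part H: GLSS 2026, Theorem 3 from Theorem 2 and (AH1) — the printed deduction, PROVED
(appended 2026-08-26, seat t6 g3)

"If we substitute (AH1) into Theorem 2 and use (averageP) we immediately obtain" Theorem 3: the
left-hand side of Theorem 2 becomes `O(M²R_P)` (weights `M − j ≤ M`, the term `j = M` has weight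
`0`), whence (thm3a) on dividing by `M`; (averageP) `Σ_{k≤2M} P_{k/2} = M − (2/π²)Σ_{j≤M}(2j−1)⁻² +
O(MR_P)` turns (thm3a) into (thm3b), the bounded constant and the truncated top bin
`0 ≤ P_M(T, M, ½) ≤ P_M(T) ≤ 1 + O(R_P)` being `O(1/M) = O(√log M/M)` for `M ≥ 3`. Hence
**`glss2026_theorem3_of_theorem2 : glss2026_theorem2 → glss2026_theorem3`**, and Theorem 4 and
Corollary 2 follow from Theorem 2 alone: after Parts D–H the GLSS 2026 results typed here rest on
ONE named fact, Theorem 2 (the Gallagher–Mueller second-moment computation of [GLSS1], §§3–4). -/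

namespace GLSS2026


/-- `Σ_{j=1}^{M} 1/(2j − 1)² ≤ 2` (compare with `Σ 1/j² ≤ 2`). [folklore] -/
private theorem sum_inv_odd_sq_le_two (M : ℕ) :
    ∑ j ∈ Finset.Icc 1 M, 1 / (2 * (j : ℝ) - 1) ^ 2 ≤ 2 := by
  calc ∑ j ∈ Finset.Icc 1 M, 1 / (2 * (j : ℝ) - 1) ^ 2
      ≤ ∑ j ∈ Finset.Icc 1 M, ((j : ℝ) ^ 2)⁻¹ := by
        refine Finset.sum_le_sum fun j hj ↦ ?_
        rw [Finset.mem_Icc] at hj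
        have hj1 : (1 : ℝ) ≤ j := by exact_mod_cast hj.1
        rw [one_div]
        apply inv_anti₀ (by positivity)
        have : (j : ℝ) ≤ 2 * (j : ℝ) - 1 := by linarith
        exact pow_le_pow_left₀ (by positivity) this 2
    _ = ∑ j ∈ Finset.Ioo 0 (M + 1), ((j : ℝ) ^ 2)⁻¹ := by
        refine Finset.sum_congr (Finset.ext fun j ↦ ⟨fun h ↦ ?_, fun h ↦ ?_⟩) fun _ _ ↦ rfl
        · rw [Finset.mem_Icc] at h
          rw [Finset.mem_Ioo]
          omega
        · rw [Finset.mem_Ioo] at h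
          rw [Finset.mem_Icc]
          omega
    _ ≤ 2 := by
        have h := sum_Ioo_inv_sq_le (α := ℝ) 0 (M + 1)
        simp only [Nat.cast_zero, zero_add, div_one] at h
        exact h

/-- `π² ≥ 4`. [folklore] -/
private theorem four_le_pi_sq : (4 : ℝ) ≤ π ^ 2 := by
  rw [show (4 : ℝ) = 2 ^ 2 by norm_num]
  exact pow_le_pow_left₀ (by norm_num) (by linarith [Real.pi_gt_three]) 2

/-- `√(log M) ≥ 1` for `M ≥ 3` (`e < 3`). [folklore] -/
private theorem one_le_sqrt_log {M : ℕ} (hM : 3 ≤ M) : 1 ≤ Real.sqrt (Real.log M) := by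
  have h3 : (3 : ℝ) ≤ M := by exact_mod_cast hM
  have hlog : 1 ≤ Real.log M := by
    rw [← Real.log_exp 1]
    apply Real.log_le_log (Real.exp_pos 1)
    have := Real.exp_one_lt_d9
    linarith
  rw [show (1 : ℝ) = Real.sqrt 1 by simp]
  exact Real.sqrt_le_sqrt hlog

/-- Step 1 of the deduction of Theorem 3: if every term `j < M` of the left-hand side of Theorem 2
is `≤ B` in absolute value (the term `j = M` has weight `M − j = 0`), then the left-hand side is
`≤ 2M²B` in absolute value. [cite: GoldstonLeeSchettlerSuriajaya2026, §1 (deduction of Theorem 3 from Theorem 2)] -/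
theorem abs_weightedSum_le {M : ℕ} {T B : ℝ} (hB : 0 ≤ B)
    (h : ∀ j ∈ (Finset.Icc 1 M).erase M,
      |AH.binDensity (2 * (j : ℤ) - 1) T M (1 / 2) + AH.binDensity (2 * (j : ℤ)) T M (1 / 2) -
        (1 - 2 / (π ^ 2 * (2 * (j : ℝ) - 1) ^ 2))| ≤ B) :
    |2 * ∑ j ∈ Finset.Icc 1 M, ((M : ℝ) - j) *
        (AH.binDensity (2 * (j : ℤ) - 1) T M (1 / 2) + AH.binDensity (2 * (j : ℤ)) T M (1 / 2) -
          (1 - 2 / (π ^ 2 * (2 * (j : ℝ) - 1) ^ 2)))| ≤ 2 * (M : ℝ) ^ 2 * B := by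
  have hM0 : (0 : ℝ) ≤ M := Nat.cast_nonneg M
  have hterm : ∀ j ∈ Finset.Icc 1 M, |((M : ℝ) - j) *
      (AH.binDensity (2 * (j : ℤ) - 1) T M (1 / 2) + AH.binDensity (2 * (j : ℤ)) T M (1 / 2) -
        (1 - 2 / (π ^ 2 * (2 * (j : ℝ) - 1) ^ 2)))| ≤ (M : ℝ) * B := by
    intro j hj
    by_cases hjM : j = M
    · subst hjM
      rw [sub_self, zero_mul, abs_zero]
      positivity
    · have hj' : j ∈ (Finset.Icc 1 M).erase M := Finset.mem_erase.mpr ⟨hjM, hj⟩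
      rw [abs_mul]
      have hjle : (j : ℝ) ≤ M := by exact_mod_cast (Finset.mem_Icc.mp hj).2
      have hj0 : (0 : ℝ) ≤ j := Nat.cast_nonneg j
      have hMj : |(M : ℝ) - j| ≤ M := by
        rw [abs_of_nonneg (by linarith)]
        linarith
      exact mul_le_mul hMj (h j hj') (abs_nonneg _) hM0
  rw [abs_mul, abs_two]
  calc 2 * |∑ j ∈ Finset.Icc 1 M, ((M : ℝ) - j) *
        (AH.binDensity (2 * (j : ℤ) - 1) T M (1 / 2) + AH.binDensity (2 * (j : ℤ)) T M (1 / 2) -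
          (1 - 2 / (π ^ 2 * (2 * (j : ℝ) - 1) ^ 2)))|
      ≤ 2 * ∑ j ∈ Finset.Icc 1 M, |((M : ℝ) - j) *
        (AH.binDensity (2 * (j : ℤ) - 1) T M (1 / 2) + AH.binDensity (2 * (j : ℤ)) T M (1 / 2) -
          (1 - 2 / (π ^ 2 * (2 * (j : ℝ) - 1) ^ 2)))| := by
        gcongr
        exact Finset.abs_sum_le_sum_abs _ _
    _ ≤ 2 * ∑ j ∈ Finset.Icc 1 M, (M : ℝ) * B := by
        gcongr with j hj
        exact hterm j hj
    _ = 2 * (M : ℝ) ^ 2 * B := by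
        rw [Finset.sum_const, Nat.card_Icc, nsmul_eq_mul]
        push_cast
        ring

/-- The level-`M` density of an odd bin `j − ½`, `1 ≤ j ≤ M`, is the `M`-free one. [cite: GoldstonLeeSchettlerSuriajaya2026, §1 eq. (1.11)] -/
theorem binDensity_odd_eq_dens {M j : ℕ} (hj : j ∈ Finset.Icc 1 M) (T : ℝ) :
    AH.binDensity (2 * (j : ℤ) - 1) T M (1 / 2) = dens (2 * (j : ℤ) - 1) T := by
  rw [Finset.mem_Icc] at hj
  refine (dens_eq_binDensity ?_).symm
  have hj2 : (j : ℝ) ≤ M := by exact_mod_cast hj.2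
  have hj1 : (1 : ℝ) ≤ j := by exact_mod_cast hj.1
  have habs : |((2 * (j : ℤ) - 1 : ℤ) : ℝ)| = 2 * (j : ℝ) - 1 := by
    rw [show ((2 * (j : ℤ) - 1 : ℤ) : ℝ) = 2 * (j : ℝ) - 1 by push_cast; ring]
    exact abs_of_nonneg (by linarith)
  rw [habs]
  linarith

/-- The level-`M` density of an even bin `j`, `1 ≤ j < M`, is the `M`-free one. [cite: GoldstonLeeSchettlerSuriajaya2026, §1 eq. (1.11)] -/
theorem binDensity_even_eq_dens {M j : ℕ} (hj : j ∈ (Finset.Icc 1 M).erase M) (T : ℝ) :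
    AH.binDensity (2 * (j : ℤ)) T M (1 / 2) = dens (2 * (j : ℤ)) T := by
  rw [Finset.mem_erase, Finset.mem_Icc] at hj
  refine (dens_eq_binDensity ?_).symm
  have hjM : j + 1 ≤ M := by omega
  have hj2 : (j : ℝ) + 1 ≤ M := by exact_mod_cast hjM
  have habs : |((2 * (j : ℤ) : ℤ) : ℝ)| = 2 * (j : ℝ) := by
    rw [show ((2 * (j : ℤ) : ℤ) : ℝ) = 2 * (j : ℝ) by push_cast; ring]
    exact abs_of_nonneg (by positivity)
  rw [habs]
  linarith

/-- The top even bin at level `M` is truncated: `0 ≤ P_M(T, M, ½) ≤ P_M(T)` (`T > 1`). [cite: GoldstonLeeSchettlerSuriajaya2026, §1 eq. (1.11)] -/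
theorem binDensity_top_le_dens {M : ℕ} {T : ℝ} (hT : 1 < T) :
    AH.binDensity (2 * (M : ℤ)) T M (1 / 2) ≤ dens (2 * (M : ℤ)) T := by
  unfold dens AH.binDensity
  have hlogT : 0 < Real.log T := Real.log_pos hT
  have hden : 0 < T / (2 * π) * Real.log T := by
    have : 0 < T := by linarith
    positivity
  refine div_le_div_of_nonneg_right ?_ hden.le
  have hsub : AH.bin (2 * (M : ℤ)) T M (1 / 2) ⊆
      AH.bin (2 * (M : ℤ)) T ((|((2 * (M : ℤ) : ℤ) : ℝ)| + 1 / 2) / 2) (1 / 2) := by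
    refine bin_mono _ _ _ ?_
    rw [show ((2 * (M : ℤ) : ℤ) : ℝ) = 2 * (M : ℝ) by push_cast; ring,
      abs_of_nonneg (by positivity)]
    linarith
  exact_mod_cast Finset.card_le_card hsub

end GLSS2026

/-- **GLSS 2026, Theorem 3 from Theorem 2 (the printed deduction, PROVED).** "Note that (AH1) …
If we substitute (AH1) into Theorem 2 and use (averageP) we immediately obtain the following average
form of (thm1b)." Substituting (AH1) (error `O(R_P)` uniform in `j`) into the left-hand side of
Theorem 2 makes it `O(M² R_P(T))` (the term `j = M` has weight `0`), whence (thm3a) on dividing by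
`M`; summing (AH1) over `1 ≤ j ≤ M` gives `Σ_{k=1}^{2M} P_{k/2} = M − (2/π²)Σ_{j≤M}(2j−1)⁻² + O(MR_P)`
(display (averageP)), whence (thm3b) from (thm3a) (the constant `(2/π²)Σ(2j−1)⁻² ≤ 1` and the
truncation of the top bin `P_M(T, M, ½) ≤ P_M(T) ≤ 1 + O(R_P)` at the theorem's level `M` are
absorbed in `O(√log M/M)`, `M ≥ 3`). Constants: `A₃ = |A₂| + 2`, `M₀,₃ = max(M₀,₂, 3)`,
`A'₃ = |A'₂| + 4|C_{AH1}|`. Modulo the named fact `glss2026_theorem2`, Theorem 3 is a theorem.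
[cite: GoldstonLeeSchettlerSuriajaya2026, Theorem 3 (deduction after (AH2))] -/
theorem glss2026_theorem3_of_theorem2 (h2 : glss2026_theorem2) : glss2026_theorem3 := by
  obtain ⟨A, M₀, hA⟩ := h2
  refine ⟨|A| + 2, max M₀ 3, fun M hM hMe R C hRC R_P hAH1 ↦ ?_⟩
  have hMM₀ : M₀ ≤ M := le_of_max_le_left hM
  have hM3 : 3 ≤ M := le_of_max_le_right hM
  obtain ⟨A', hT2⟩ := hA M hMM₀ hMe R C hRC
  obtain ⟨hRP0, -, -, C₁, hAH1ev⟩ := hAH1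
  have hR0 : ∀ T, 0 < R T := hRC.1
  refine ⟨|A'| + 4 * |C₁|, ?_⟩
  filter_upwards [hT2, hAH1ev, eventually_gt_atTop 1] with T h2T h1T hT1
  -- positivity bookkeeping
  have hMpos : (0 : ℝ) < M := by exact_mod_cast (show 0 < M by omega)
  have hM1 : (1 : ℝ) ≤ M := by exact_mod_cast (show 1 ≤ M by omega)
  have hsq : 1 ≤ Real.sqrt (Real.log M) := GLSS2026.one_le_sqrt_log hM3
  have hRT : 0 ≤ R T := (hR0 T).le
  have hRPT : 0 ≤ R_P T := (hRP0 T).le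
  have hL2 : 0 ≤ 1 / GLSS2026.L T ^ 2 := by positivity
  set E : ℝ := R T + R_P T + 1 / GLSS2026.L T ^ 2 with hE
  have hE0 : 0 ≤ E := by positivity
  have hRPE : R_P T ≤ E := by linarith
  set X : ℝ := Real.sqrt (Real.log M) / M with hX
  set Y : ℝ := (M : ℝ) * E with hY
  have hX0 : 0 ≤ X := by positivity
  have hY0 : 0 ≤ Y := by positivity
  have hMX : 1 / (M : ℝ) ≤ X := div_le_div_of_nonneg_right hsq hMpos.le
  have hRPY : R_P T ≤ Y := hRPE.trans (le_mul_of_one_le_left hE0 hM1)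
  have hC₁0 : 0 ≤ |C₁| := abs_nonneg _
  -- (AH1) with `|C₁|`
  have hAH1' : ∀ j : ℕ, 1 ≤ j →
      |GLSS2026.dens (2 * j - 1) T + GLSS2026.dens (2 * j) T -
        (1 - 2 / (π ^ 2 * (2 * (j : ℝ) - 1) ^ 2))| ≤ |C₁| * R_P T := fun j hj ↦
    (h1T j hj).trans (mul_le_mul_of_nonneg_right (le_abs_self _) hRPT)
  -- abbreviations for the sums
  set s : Finset ℕ := Finset.Icc 1 M with hs
  have hMs : M ∈ s := Finset.mem_Icc.mpr ⟨by omega, le_rfl⟩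
  have hcard : s.card = M := by simp [hs]
  set D0 : ℝ := AH.binDensity 0 T M (1 / 2) with hD0
  set DM : ℝ := AH.binDensity (2 * (M : ℤ)) T M (1 / 2) with hDM
  set dM : ℝ := GLSS2026.dens (2 * (M : ℤ)) T with hdM
  set Sodd : ℝ := ∑ j ∈ s, AH.binDensity (2 * (j : ℤ) - 1) T M (1 / 2) with hSodd
  set Seven : ℝ := ∑ j ∈ s, AH.binDensity (2 * (j : ℤ)) T M (1 / 2) with hSeven
  set LHS : ℝ := 2 * ∑ j ∈ s, ((M : ℝ) - j) *
      (AH.binDensity (2 * (j : ℤ) - 1) T M (1 / 2) + AH.binDensity (2 * (j : ℤ)) T M (1 / 2) -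
        (1 - 2 / (π ^ 2 * (2 * (j : ℝ) - 1) ^ 2))) with hLHS
  -- Step 1: `|LHS| ≤ 2 M² |C₁| R_P`
  have hLHS_le : |LHS| ≤ 2 * (M : ℝ) ^ 2 * (|C₁| * R_P T) := by
    refine GLSS2026.abs_weightedSum_le (by positivity) fun j hj ↦ ?_
    have hj1 : 1 ≤ j := (Finset.mem_Icc.mp (Finset.mem_of_mem_erase hj)).1
    rw [GLSS2026.binDensity_odd_eq_dens (Finset.mem_of_mem_erase hj),
      GLSS2026.binDensity_even_eq_dens hj]
    exact hAH1' j hj1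
  -- Step 2: (thm3a) times `M`
  have hRHS : |(3 / 2 - D0) * M - Sodd| ≤
      |A| * Real.sqrt (Real.log M) + (2 * |C₁| + |A'|) * (M : ℝ) ^ 2 * E := by
    have h' : |(3 / 2 - D0) * M - Sodd| - |LHS| ≤ |LHS - ((3 / 2 - D0) * M - Sodd)| := by
      rw [abs_sub_comm LHS]
      exact abs_sub_abs_le_abs_sub _ _
    have hA1 : A * Real.sqrt (Real.log M) ≤ |A| * Real.sqrt (Real.log M) :=
      mul_le_mul_of_nonneg_right (le_abs_self A) (Real.sqrt_nonneg _)
    have hA2 : A' * (M : ℝ) ^ 2 * (R T + 1 / GLSS2026.L T ^ 2) ≤ |A'| * (M : ℝ) ^ 2 * E := by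
      calc A' * (M : ℝ) ^ 2 * (R T + 1 / GLSS2026.L T ^ 2)
          ≤ |A'| * (M : ℝ) ^ 2 * (R T + 1 / GLSS2026.L T ^ 2) :=
            mul_le_mul_of_nonneg_right (mul_le_mul_of_nonneg_right (le_abs_self A') (by positivity))
              (by positivity)
        _ ≤ |A'| * (M : ℝ) ^ 2 * E := by
            refine mul_le_mul_of_nonneg_left ?_ (by positivity)
            linarith
    have hC1 : 2 * (M : ℝ) ^ 2 * (|C₁| * R_P T) ≤ 2 * (M : ℝ) ^ 2 * (|C₁| * E) := by gcongr
    have hexp : (2 * |C₁| + |A'|) * (M : ℝ) ^ 2 * E =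
        2 * (M : ℝ) ^ 2 * (|C₁| * E) + |A'| * (M : ℝ) ^ 2 * E := by ring
    rw [hexp]
    linarith [h2T, h', hLHS_le, hA1, hA2, hC1]
  have ha : |(3 / 2 - D0) - Sodd / M| ≤ |A| * X + (2 * |C₁| + |A'|) * Y := by
    have e : (3 / 2 - D0) - Sodd / M = ((3 / 2 - D0) * M - Sodd) / M := by
      field_simp
    rw [e, abs_div, abs_of_pos hMpos, div_le_iff₀ hMpos]
    have e2 : (|A| * X + (2 * |C₁| + |A'|) * Y) * M =
        |A| * Real.sqrt (Real.log M) + (2 * |C₁| + |A'|) * (M : ℝ) ^ 2 * E := by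
      rw [hX, hY]
      calc (|A| * (Real.sqrt (Real.log M) / M) + (2 * |C₁| + |A'|) * (M * E)) * M
          = |A| * (Real.sqrt (Real.log M) / M * M) + (2 * |C₁| + |A'|) * (M : ℝ) ^ 2 * E := by
            ring
        _ = _ := by rw [div_mul_cancel₀ _ hMpos.ne']
    rw [e2]
    exact hRHS
  -- Step 3: (thm3b) via (averageP)
  set SM : ℝ := ∑ j ∈ s, 1 / (2 * (j : ℝ) - 1) ^ 2 with hSM
  have hSM0 : 0 ≤ SM := Finset.sum_nonneg fun j _ ↦ by positivity
  have hSM2 : SM ≤ 2 := GLSS2026.sum_inv_odd_sq_le_two M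
  have hsum_c : ∑ j ∈ s, (1 - 2 / (π ^ 2 * (2 * (j : ℝ) - 1) ^ 2)) = M - 2 / π ^ 2 * SM := by
    rw [Finset.sum_sub_distrib, Finset.sum_const, hcard, nsmul_eq_mul, mul_one, hSM,
      Finset.mul_sum]
    congr 1
    refine Finset.sum_congr rfl fun j _ ↦ ?_
    have hπ : (π : ℝ) ^ 2 ≠ 0 := by positivity
    field_simp
  set err2 : ℝ := ∑ j ∈ s, (GLSS2026.dens (2 * (j : ℤ) - 1) T + GLSS2026.dens (2 * (j : ℤ)) T -
      (1 - 2 / (π ^ 2 * (2 * (j : ℝ) - 1) ^ 2))) with herr2_def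
  have herr2 : |err2| ≤ M * (|C₁| * R_P T) := by
    calc |err2| ≤ ∑ j ∈ s, |GLSS2026.dens (2 * (j : ℤ) - 1) T + GLSS2026.dens (2 * (j : ℤ)) T -
          (1 - 2 / (π ^ 2 * (2 * (j : ℝ) - 1) ^ 2))| := Finset.abs_sum_le_sum_abs _ _
      _ ≤ ∑ j ∈ s, |C₁| * R_P T :=
          Finset.sum_le_sum fun j hj ↦ hAH1' j (Finset.mem_Icc.mp hj).1
      _ = M * (|C₁| * R_P T) := by rw [Finset.sum_const, hcard, nsmul_eq_mul]
  have e_err2 : err2 = ∑ j ∈ s, GLSS2026.dens (2 * (j : ℤ) - 1) T +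
      ∑ j ∈ s, GLSS2026.dens (2 * (j : ℤ)) T - (M - 2 / π ^ 2 * SM) := by
    rw [← hsum_c, herr2_def, Finset.sum_sub_distrib, Finset.sum_add_distrib]
  have e_odd : Sodd = ∑ j ∈ s, GLSS2026.dens (2 * (j : ℤ) - 1) T :=
    Finset.sum_congr rfl fun j hj ↦ GLSS2026.binDensity_odd_eq_dens hj T
  have e_even_D : Seven = DM + ∑ j ∈ s.erase M, AH.binDensity (2 * (j : ℤ)) T M (1 / 2) :=
    (Finset.add_sum_erase s _ hMs).symm
  have e_even_d : ∑ j ∈ s, GLSS2026.dens (2 * (j : ℤ)) T =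
      dM + ∑ j ∈ s.erase M, GLSS2026.dens (2 * (j : ℤ)) T :=
    (Finset.add_sum_erase s _ hMs).symm
  have e_s' : ∑ j ∈ s.erase M, AH.binDensity (2 * (j : ℤ)) T M (1 / 2) =
      ∑ j ∈ s.erase M, GLSS2026.dens (2 * (j : ℤ)) T :=
    Finset.sum_congr rfl fun j hj ↦ GLSS2026.binDensity_even_eq_dens hj T
  -- the top bin: `0 ≤ DM ≤ dM ≤ 1 + |C₁| R_P`
  have hDM0 : 0 ≤ DM := GLSS2026.binDensity_nonneg _ hT1 _ _
  have hDM1 : DM ≤ dM := GLSS2026.binDensity_top_le_dens hT1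
  have hdM1 : dM ≤ 1 + |C₁| * R_P T := by
    have h := (abs_le.mp (hAH1' M (by omega))).2
    have hnn : 0 ≤ GLSS2026.dens (2 * (M : ℤ) - 1) T := by
      unfold GLSS2026.dens
      exact GLSS2026.binDensity_nonneg _ hT1 _ _
    have hc : 0 ≤ 2 / (π ^ 2 * (2 * (M : ℝ) - 1) ^ 2) := by positivity
    linarith
  -- the identity behind (thm3b)
  have hid : (D0 - 1 / 2) - Seven / M =
      -((3 / 2 - D0) - Sodd / M) - err2 / M + (dM - DM) / M + 2 / π ^ 2 * SM / M := by
    rw [e_err2, e_odd, e_even_D, e_even_d, e_s']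
    field_simp
    ring
  -- component bounds
  have hb1 : |err2 / M| ≤ |C₁| * Y := by
    rw [abs_div, abs_of_pos hMpos, div_le_iff₀ hMpos]
    calc |err2| ≤ M * (|C₁| * R_P T) := herr2
      _ ≤ M * (|C₁| * Y) := by gcongr
      _ = |C₁| * Y * M := by ring
  have hb2 : 0 ≤ (dM - DM) / M := div_nonneg (by linarith) hMpos.le
  have hb3 : (dM - DM) / M ≤ X + |C₁| * Y := by
    calc (dM - DM) / M ≤ (1 + |C₁| * R_P T) / M := by
          gcongr
          linarith
      _ = 1 / M + |C₁| * (R_P T / M) := by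
          field_simp
      _ ≤ X + |C₁| * Y := by
          gcongr
          calc R_P T / M ≤ R_P T := div_le_self hRPT hM1
            _ ≤ Y := hRPY
  have hb4 : 0 ≤ 2 / π ^ 2 * SM / M := by positivity
  have hb5 : 2 / π ^ 2 * SM / M ≤ X := by
    have hπ2 : (4 : ℝ) ≤ π ^ 2 := GLSS2026.four_le_pi_sq
    have h1 : 2 / π ^ 2 * SM ≤ 1 := by
      rw [div_mul_eq_mul_div, div_le_one (by positivity : (0 : ℝ) < π ^ 2)]
      linarith
    calc 2 / π ^ 2 * SM / M ≤ 1 / M := by gcongr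
      _ ≤ X := hMX
  have hfin : |A| * X + (2 * |C₁| + |A'|) * Y + |C₁| * Y + (X + |C₁| * Y) + X =
      (|A| + 2) * Real.sqrt (Real.log M) / M + (|A'| + 4 * |C₁|) * M * E := by
    rw [hX, hY]
    ring
  constructor
  · -- (thm3a)
    calc |(3 / 2 - D0) - Sodd / M| ≤ |A| * X + (2 * |C₁| + |A'|) * Y := ha
      _ ≤ |A| * X + (2 * |C₁| + |A'|) * Y + |C₁| * Y + (X + |C₁| * Y) + X := by
          have : 0 ≤ |C₁| * Y := by positivity
          linarith
      _ = _ := hfin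
  · -- (thm3b)
    rw [hid]
    have haa := abs_le.mp ha
    have hbb := abs_le.mp hb1
    calc |-((3 / 2 - D0) - Sodd / M) - err2 / M + (dM - DM) / M + 2 / π ^ 2 * SM / M|
        ≤ |A| * X + (2 * |C₁| + |A'|) * Y + |C₁| * Y + (X + |C₁| * Y) + X := by
          rw [abs_le]
          constructor <;> linarith
      _ = _ := hfin

/-- **GLSS 2026, Theorem 4 from Theorem 2 alone** (Theorem 3 from Theorem 2, Corollary 1 a theorem
of the tree). [cite: GoldstonLeeSchettlerSuriajaya2026, Theorem 4] -/
theorem glss2026_theorem4_of_theorem2 (h2 : glss2026_theorem2) : glss2026_theorem4 :=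
  glss2026_theorem4_of_theorem3 (glss2026_theorem3_of_theorem2 h2)

/-- **GLSS 2026, Corollary 2 from Theorem 2 alone.** [cite: GoldstonLeeSchettlerSuriajaya2026, Corollary 2] -/
theorem glss2026_corollary2_of_theorem2 (h2 : glss2026_theorem2) : glss2026_corollary2 :=
  glss2026_corollary2_of_theorem3 (glss2026_theorem3_of_theorem2 h2)

end Literature.NumberTheory.LFunctions

end
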